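import Literature.Analysis.FluidPDE.TaoAveragedJointWeightData
import Literature.Analysis.FluidPDE.TaoAveragedTorusAveraging
import HarnessLib

/-!
# Tao 2016, §3.5–§3.9: the rotation average with a smooth joint weight — proof

T. Tao, *Finite time blowup for an averaged three-dimensional Navier–Stokes equation*,
J. Amer. Math. Soc. **29** (2016), 601–674 = arXiv:1402.0290v3, §3.5–3.9 pp. 17–20.

This file discharges the named fact `rotationAverage_jointWeight`
(`TaoAveragedRotationAveraging.lean`): `theorem rotationAverage_jointWeight_holds`.  With the data
`(d, μ₀, E, F) = (4, jointMeasure, jointE, jointF ψ)` of `TaoAveragedJointWeightData.lean`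
(quaternion coordinates on the rotation parameters), the chain of the proof is

1. (`jointWeightAverage_congr_ae`) the `Xⱼ` may be replaced by strongly measurable
   representatives (preimages of null sets under `p ↦ R pⱼ` are null);
2. (`integral_jointMeasure`, Fubini) the average is `∫∫ G(q, ξ) dξ dq = ∫ (∫ G(q, ξ) dq) dξ` with
   `G = ∏g₀(|qⱼ|) · w F̃' Λ(Y)` integrable (`integrable_Gfun`: domination by the disintegration
   weight times `∏ⱼ|Xⱼ(ζⱼ)|`, `lintegral_rotWeight_prod_le`);
3. (**the fibre step**, `fibre_step`) for good `ξ` the weight `w` is `1`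
   (`singleScaleWeight_eq_one_of_cutoffs`), inserting the torus average over the angles
   (`integral_eq_integral_torusAverage`, §3.7) and the **fibre identity** `torus_integral_core` —
   Fourier extraction on `(ℝ/2πℤ)³` (`integral_torus_extract_sum`, (3.23)) and the synthesis
   (`fibre_synthesis`, (3.20)–(3.21), non-degenerate by (3.24)) — turn `∫ G(q, ξ) dq` into
   `∫ N(q, ξ) dq`, `N = ∏g₀ · realCut · ∏ⱼ Xⱼ(ζⱼ)·P_{ζⱼ}\overline{ψ̂ⱼ(ζⱼ)}`;
4. (`integral_Nfun`) the disintegration `integral_rotFreq_withDensity` (§3.6, the change of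
   variables (3.15)–(3.16)) and the normalisation `density_mul_zCut3` give
   `∫ N = ∫ χ(ζ) ∏ⱼ Xⱼ(ζⱼ)·P aⱼ(ζⱼ) dζ`, which factorises (`integral_zCut3_hProd`);
5. (`slot_integral_eq`) `χⱼ = 1` on `supp ψ̂ⱼ` and `Xⱼ · P aⱼ = Xⱼ · aⱼ` for divergence-free `Xⱼ`.

## References

* T. Tao, J. Amer. Math. Soc. 29 (2016), 601–674, arXiv:1402.0290v3, §3.5–3.9 pp. 17–20.
  Key `Tao2016AveragedNS`.
-/

noncomputable section

open Real MeasureTheory Quaternion Set FourierTransform intervalIntegral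
open scoped RealInnerProductSpace Quaternion ENNReal ComplexConjugate SchwartzMap

namespace Literature.Analysis.FluidPDE.Tao2016

/-- Local notation for physical / frequency space `ℝ³`. -/
local notation "ℝ³" => EuclideanSpace ℝ (Fin 3)
/-- Local notation for the complexified range `ℂ³`. -/
local notation "ℂ³" => EuclideanSpace ℂ (Fin 3)

open FunctionSpaces.EuclideanSpace (complexify complexify_apply)

attribute [local instance] quatMeasurableSpace quatBorelSpace

/-! ## The proof of `rotationAverage_jointWeight`

### Changing the `Xⱼ` on null sets -/

section AEcongr

variable {X X' : ℝ³ → ℂ³}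

/-- `X =ᵐ X'` implies `X ∘ R ∘ pr₁ =ᵐ X' ∘ R ∘ pr₁` on `(ℝ³)²` for an isometry `R`. [folklore] -/
theorem ae_comp_isometry_fst (h : X =ᵐ[volume] X') (R : ℝ³ ≃ₗᵢ[ℝ] ℝ³) :
    ∀ᵐ p : ℝ³ × ℝ³, X (R p.1) = X' (R p.1) := by
  have h1 : (X ∘ R) =ᵐ[volume] (X' ∘ R) := R.measurePreserving.quasiMeasurePreserving.ae_eq h
  have h2 := (Measure.quasiMeasurePreserving_fst (μ := (volume : Measure ℝ³)) (ν := (volume : Measure ℝ³))).ae_eq h1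
  exact h2

/-- `X =ᵐ X'` implies `X ∘ R ∘ pr₂ =ᵐ X' ∘ R ∘ pr₂` on `(ℝ³)²` for an isometry `R`. [folklore] -/
theorem ae_comp_isometry_snd (h : X =ᵐ[volume] X') (R : ℝ³ ≃ₗᵢ[ℝ] ℝ³) :
    ∀ᵐ p : ℝ³ × ℝ³, X (R p.2) = X' (R p.2) := by
  have h1 : (X ∘ R) =ᵐ[volume] (X' ∘ R) := R.measurePreserving.quasiMeasurePreserving.ae_eq h
  have h2 := (Measure.quasiMeasurePreserving_snd (μ := (volume : Measure ℝ³)) (ν := (volume : Measure ℝ³))).ae_eq h1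
  exact h2

/-- `X =ᵐ X'` implies `X(R(-p₁-p₂)) = X'(R(-p₁-p₂))` a.e. on `(ℝ³)²` for an isometry `R`. [folklore] -/
theorem ae_comp_isometry_neg (h : X =ᵐ[volume] X') (R : ℝ³ ≃ₗᵢ[ℝ] ℝ³) :
    ∀ᵐ p : ℝ³ × ℝ³, X (R (-p.1 - p.2)) = X' (R (-p.1 - p.2)) := by
  have h1 : (X ∘ R) =ᵐ[volume] (X' ∘ R) := R.measurePreserving.quasiMeasurePreserving.ae_eq h
  have hq : Measure.QuasiMeasurePreserving (fun p : ℝ³ × ℝ³ => -p.1 - p.2) volume volume := by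
    have h3 := (Measure.quasiMeasurePreserving_snd (μ := (volume : Measure ℝ³)) (ν := (volume : Measure ℝ³))).comp
      measurePreserving_shearNeg.quasiMeasurePreserving
    exact h3
  exact hq.ae_eq h1

/-- **The rotation average depends on the `Xⱼ` only up to null sets.** [folklore] -/
theorem jointWeightAverage_congr_ae {V : Type*} [MeasurableSpace V] (μ₀ : Measure V)
    (E : Fin 3 → V → (ℝ³ ≃ₗᵢ[ℝ] ℝ³)) (ε₀ : ℝ) (F : V × (ℝ³ × ℝ³) → ℂ) {X₁ X₁' X₂ X₂' X₃ X₃' : ℝ³ → ℂ³}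
    (h₁ : X₁ =ᵐ[volume] X₁') (h₂ : X₂ =ᵐ[volume] X₂') (h₃ : X₃ =ᵐ[volume] X₃') :
    jointWeightAverage μ₀ E ε₀ F X₁ X₂ X₃ = jointWeightAverage μ₀ E ε₀ F X₁' X₂' X₃' := by
  unfold jointWeightAverage
  refine integral_congr_ae (Filter.Eventually.of_forall fun w => ?_)
  refine integral_congr_ae ?_
  filter_upwards [ae_comp_isometry_fst h₁ (E 0 w).symm, ae_comp_isometry_snd h₂ (E 1 w).symm,
    ae_comp_isometry_neg h₃ (E 2 w).symm] with p hp1 hp2 hp3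
  simp only [hp1, hp2, hp3]

/-- The right-hand side pairings depend on `X` only up to null sets. [folklore] -/
theorem integral_cdot_congr_ae (h : X =ᵐ[volume] X') (a : ℝ³ → ℂ³) :
    ∫ ξ, cdot (X ξ) (a ξ) = ∫ ξ, cdot (X' ξ) (a ξ) := by
  refine integral_congr_ae ?_
  filter_upwards [h] with ξ hξ
  rw [hξ]

/-- `FreqIntegrable` is invariant under a.e. modification. [folklore] -/
theorem FreqIntegrable.congr_ae (hX : FreqIntegrable X) (h : X =ᵐ[volume] X') : FreqIntegrable X' :=
  ⟨hX.1.congr h, hX.2.ae_eq h⟩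

/-- `FreqDivFree` is invariant under a.e. modification. [folklore] -/
theorem FreqDivFree.congr_ae (hX : FreqDivFree X) (h : X =ᵐ[volume] X') : FreqDivFree X' := by
  unfold FreqDivFree at hX ⊢
  filter_upwards [hX, h] with ξ h1 h2
  rw [← h2, h1]

end AEcongr

/-! ### Pointwise evaluations on the support -/

section Pointwise

variable {ε₀ : ℝ} (ψ : Fin 3 → 𝓢(ℝ³, ℂ³))

/-- `cdot 0 b = 0`. [folklore] -/
theorem cdot_zero_left (b : ℂ³) : cdot 0 b = 0 := by simp [cdot]

/-- `cdot a 0 = 0`. [folklore] -/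
theorem cdot_zero_right' (a : ℂ³) : cdot a 0 = 0 := by simp [cdot]

/-- `P_ζ 0 = 0`. [folklore] -/
theorem projPerp_zero (ζ : ℝ³) : projPerp ζ 0 = 0 := by
  rw [projPerp, cdot_zero_left, zero_smul, sub_zero]

/-- `|P_ζ v| ≤ 2 |v|`. [folklore] -/
theorem norm_projPerp_le (ζ : ℝ³) (v : ℂ³) : ‖projPerp ζ v‖ ≤ 2 * ‖v‖ := by
  rw [projPerp]
  have hu : ‖complexify (udir ζ)‖ ≤ 1 := by
    rw [FunctionSpaces.EuclideanSpace.norm_complexify]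
    by_cases h : ζ = 0
    · rw [h, udir, norm_zero, inv_zero, zero_smul, norm_zero]; exact zero_le_one
    · rw [norm_udir h]
  calc _ ≤ ‖v‖ + ‖cdot v (complexify (udir ζ)) • complexify (udir ζ)‖ := norm_sub_le _ _
    _ ≤ ‖v‖ + ‖v‖ * 1 * 1 := by
        rw [norm_smul]
        gcongr
        · calc ‖cdot v (complexify (udir ζ))‖ ≤ ‖v‖ * ‖complexify (udir ζ)‖ := norm_cdot_le _ _
            _ ≤ ‖v‖ * 1 := by gcongr
    _ = 2 * ‖v‖ := by ring

/-- **`X · P_ζ a = X · a` for divergence-free `X`** (the Leray projection is harmless): if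
`ζ · X(ζ) = 0` then `X(ζ) · P_ζ a = X(ζ) · a`. [cite: Tao2016AveragedNS, §3.5 p. 17] -/
theorem cdot_projPerp_of_divFree {ζ : ℝ³} {x : ℂ³} (hx : cdot (complexify ζ) x = 0) (a : ℂ³) :
    cdot x (projPerp ζ a) = cdot x a := by
  rw [projPerp, cdot_sub_right, cdot_smul_right]
  have : cdot x (complexify (udir ζ)) = 0 := by
    rw [udir, LinearIsometry.map_smul, ← Complex.coe_smul, cdot_smul_right, cdot_comm' x, hx, mul_zero]
  rw [this, mul_zero, sub_zero]

/-- **One slot of the final product**: for `ψ̂` supported in `B̄(ξⱼ⁰, ε₀³)` and divergence-free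
`X`, `∫ χⱼ(ζ) X(ζ)·P_ζ\overline{ψ̂(ζ)} dζ = ∫ X(ζ)·\overline{ψ̂(ζ)} dζ`. [cite: Tao2016AveragedNS, §3.5–3.6 pp. 17–18] -/
theorem slot_integral_eq (hε : 0 < ε₀) {φ : 𝓢(ℝ³, ℂ³)} {j : Fin 3} (hφ : HasBallFourierSupport (xi0 j) (ε₀ ^ 3) φ)
    {X : ℝ³ → ℂ³} (hd : FreqDivFree X) :
    ∫ ζ, (((zetaBump hε j) ζ : ℝ) : ℂ) * cdot (X ζ) (projPerp ζ (conj3 (𝓕 (⇑φ) ζ))) =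
      ∫ ζ, cdot (X ζ) (conj3 (𝓕 (⇑φ) ζ)) := by
  refine integral_congr_ae ?_
  filter_upwards [hd] with ζ hζ
  by_cases h0 : 𝓕 (⇑φ) ζ = 0
  · rw [h0, map_zero, projPerp_zero, cdot_zero_right', mul_zero]
  · have hdist : dist ζ (xi0 j) ≤ ε₀ ^ 3 := by
      by_contra hlt
      exact h0 (hφ ζ (not_le.mp hlt))
    have h1 : (zetaBump hε j) ζ = 1 := (zetaBump hε j).one_of_mem_closedBall (by
      rw [Metric.mem_closedBall]; exact hdist)
    rw [h1, cdot_projPerp_of_divFree hζ]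
    push_cast
    ring

/-- The cut-off in the un-rotated frequencies as a function on `(ℝ³)³`. [folklore] -/
def zCut3 (hε : 0 < ε₀) (ζ : ℝ³ × ℝ³ × ℝ³) : ℝ :=
  (zetaBump hε 0) ζ.1 * (zetaBump hε 1) ζ.2.1 * (zetaBump hε 2) ζ.2.2

/-- `zCut = zCut3 ∘ rotFreq`. [folklore] -/
theorem zCut_eq_zCut3 (hε : 0 < ε₀) (q : ℍ × ℍ × ℍ) (p : ℝ³ × ℝ³) : zCut hε q p = zCut3 hε (rotFreq (q, p)) := rfl

/-- `0 ≤ zCut3 ≤ 1`. [folklore] -/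
theorem zCut3_nonneg_le_one (hε : 0 < ε₀) (ζ : ℝ³ × ℝ³ × ℝ³) : 0 ≤ zCut3 hε ζ ∧ zCut3 hε ζ ≤ 1 :=
  ⟨mul_nonneg (mul_nonneg (zetaBump hε 0).nonneg (zetaBump hε 1).nonneg) (zetaBump hε 2).nonneg,
    mul_le_one₀ (mul_le_one₀ (zetaBump hε 0).le_one (zetaBump hε 1).nonneg (zetaBump hε 1).le_one)
      (zetaBump hε 2).nonneg (zetaBump hε 2).le_one⟩

/-- `zCut3` is continuous. [folklore] -/
theorem continuous_zCut3 (hε : 0 < ε₀) : Continuous (zCut3 hε) := by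
  unfold zCut3
  exact (((zetaBump hε 0).continuous.comp continuous_fst).mul
    ((zetaBump hε 1).continuous.comp (continuous_fst.comp continuous_snd))).mul
    ((zetaBump hε 2).continuous.comp (continuous_snd.comp continuous_snd))

/-- On the support of `zCut3` all three frequencies are within `2ε₀³` of (3.7). [folklore] -/
theorem near_of_zCut3_ne_zero (hε : 0 < ε₀) {ζ : ℝ³ × ℝ³ × ℝ³} (h : zCut3 hε ζ ≠ 0) :
    dist ζ.1 (xi0 0) < 2 * ε₀ ^ 3 ∧ dist ζ.2.1 (xi0 1) < 2 * ε₀ ^ 3 ∧ dist ζ.2.2 (xi0 2) < 2 * ε₀ ^ 3 := by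
  unfold zCut3 at h
  simp only [mul_ne_zero_iff] at h
  obtain ⟨⟨h0, h1⟩, h2⟩ := h
  exact ⟨bump_dist_lt_of_ne_zero _ h0, bump_dist_lt_of_ne_zero _ h1, bump_dist_lt_of_ne_zero _ h2⟩

/-- **The triangle weight of the magnitude cut-off is at most `1`.** [folklore] -/
theorem triWeight_Rweight_le_one (hε : 0 < ε₀) (ζ : ℝ³ × ℝ³ × ℝ³) : triWeight (Rweight hε) ζ ≤ 1 := by
  unfold triWeight Rweight
  have hind : (Ioo |‖ζ.2.2‖ - ‖ζ.1‖| (‖ζ.2.2‖ + ‖ζ.1‖)).indicator (fun _ => (1 : ℝ≥0∞)) ‖ζ.2.1‖ ≤ 1 := by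
    by_cases h : ‖ζ.2.1‖ ∈ Ioo |‖ζ.2.2‖ - ‖ζ.1‖| (‖ζ.2.2‖ + ‖ζ.1‖)
    · rw [indicator_of_mem h]
    · rw [indicator_of_notMem h]; exact zero_le_one
  set r := ‖ζ.1‖ * ‖ζ.2.1‖ * ‖ζ.2.2‖ with hr
  set κ := (kappaBump hε 0) ‖ζ.1‖ * (kappaBump hε 1) ‖ζ.2.1‖ * (kappaBump hε 2) ‖ζ.2.2‖ with hκ
  have hκ0 : 0 ≤ κ := mul_nonneg (mul_nonneg (kappaBump hε 0).nonneg (kappaBump hε 1).nonneg) (kappaBump hε 2).nonneg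
  have hκ1 : κ ≤ 1 := mul_le_one₀ (mul_le_one₀ (kappaBump hε 0).le_one (kappaBump hε 1).nonneg (kappaBump hε 1).le_one)
    (kappaBump hε 2).nonneg (kappaBump hε 2).le_one
  have hr0 : 0 ≤ r := by positivity
  have h2 : ENNReal.ofReal (r * κ) * ENNReal.ofReal r⁻¹ ≤ 1 := by
    rw [← ENNReal.ofReal_mul (by positivity)]
    refine ENNReal.ofReal_le_one.mpr ?_
    by_cases hr' : r = 0
    · rw [hr', zero_mul, zero_mul]; exact zero_le_one
    · rw [mul_comm, ← mul_assoc, inv_mul_cancel₀ hr', one_mul]; exact hκ1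
  calc _ ≤ 1 * (ENNReal.ofReal (r * κ) * ENNReal.ofReal r⁻¹) := by rw [mul_assoc]; gcongr
    _ ≤ 1 * 1 := by gcongr
    _ = 1 := one_mul 1

/-- **The triangle weight is `1` near (3.7)** (`ε₀ ≤ 1/10`): there the magnitude cut-offs are `1`
and the three magnitudes satisfy the strict triangle inequalities. [folklore] -/
theorem triWeight_Rweight_eq_one (hε : 0 < ε₀) (hε1 : ε₀ ≤ 1 / 10) {ζ : ℝ³ × ℝ³ × ℝ³}
    (h0 : dist ζ.1 (xi0 0) < 2 * ε₀ ^ 3) (h1 : dist ζ.2.1 (xi0 1) < 2 * ε₀ ^ 3) (h2 : dist ζ.2.2 (xi0 2) < 2 * ε₀ ^ 3) :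
    triWeight (Rweight hε) ζ = 1 := by
  have ht0 : 0 < ε₀ ^ 3 := eps_cube_pos hε
  have ht1 : ε₀ ^ 3 ≤ 1 / 1000 := by
    calc ε₀ ^ 3 ≤ (1 / 10) ^ 3 := by gcongr
      _ = 1 / 1000 := by norm_num
  have hs : (1.41 : ℝ) < Real.sqrt 2 ∧ Real.sqrt 2 < 1.42 := by
    constructor
    · rw [show (1.41 : ℝ) = Real.sqrt (1.41 ^ 2) by rw [Real.sqrt_sq (by norm_num)]]
      exact Real.sqrt_lt_sqrt (by norm_num) (by norm_num)
    · rw [show (1.42 : ℝ) = Real.sqrt (1.42 ^ 2) by rw [Real.sqrt_sq (by norm_num)]]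
      exact Real.sqrt_lt_sqrt (by norm_num) (by norm_num)
  -- radii
  have hr : ∀ {v c : ℝ³}, dist v c < 2 * ε₀ ^ 3 → |‖v‖ - ‖c‖| < 2 * ε₀ ^ 3 := fun {v c} h =>
    lt_of_le_of_lt (abs_norm_sub_norm_le v c) (by rwa [dist_eq_norm] at h)
  have hr0 := hr h0; have hr1 := hr h1; have hr2 := hr h2
  rw [norm_xi0_zero] at hr0; rw [norm_xi0_one] at hr1; rw [norm_xi0_two] at hr2
  obtain ⟨a0, b0⟩ := abs_lt.mp hr0
  obtain ⟨a1, b1⟩ := abs_lt.mp hr1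
  obtain ⟨a2, b2⟩ := abs_lt.mp hr2
  have hk : ∀ (j : Fin 3) {r : ℝ}, |r - ‖xi0 j‖| < 2 * ε₀ ^ 3 → (kappaBump hε j) r = 1 := fun j {r} h =>
    (kappaBump hε j).one_of_mem_closedBall (by rw [Metric.mem_closedBall, Real.dist_eq, kappaBump_rIn]; exact h.le)
  have k0 : (kappaBump hε 0) ‖ζ.1‖ = 1 := hk 0 (by rw [norm_xi0_zero]; exact hr0)
  have k1 : (kappaBump hε 1) ‖ζ.2.1‖ = 1 := hk 1 (by rw [norm_xi0_one]; exact hr1)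
  have k2 : (kappaBump hε 2) ‖ζ.2.2‖ = 1 := hk 2 (by rw [norm_xi0_two]; exact hr2)
  have hmem : ‖ζ.2.1‖ ∈ Ioo |‖ζ.2.2‖ - ‖ζ.1‖| (‖ζ.2.2‖ + ‖ζ.1‖) := by
    constructor
    · rw [abs_lt]; constructor <;> linarith
    · linarith
  have hrpos : 0 < ‖ζ.1‖ * ‖ζ.2.1‖ * ‖ζ.2.2‖ := by
    have : 0 < ‖ζ.1‖ := by linarith
    have : 0 < ‖ζ.2.1‖ := by linarith
    have : 0 < ‖ζ.2.2‖ := by linarith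
    positivity
  unfold triWeight Rweight
  rw [indicator_of_mem hmem, k0, k1, k2, mul_one, mul_one, mul_one, one_mul, ← ENNReal.ofReal_mul hrpos.le,
    mul_inv_cancel₀ hrpos.ne', ENNReal.ofReal_one]

/-- **The normalised density is the cut-off**: `(C · triWeight(ζ)) · C⁻¹ χ(ζ) = χ(ζ)`. [folklore] -/
theorem density_mul_zCut3 (hε : 0 < ε₀) (hε1 : ε₀ ≤ 1 / 10) (ζ : ℝ³ × ℝ³ × ℝ³) :
    (rotDensityConstE hε * triWeight (Rweight hε) ζ).toReal * ((rotDensityConst hε)⁻¹ * zCut3 hε ζ) = zCut3 hε ζ := by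
  by_cases hz : zCut3 hε ζ = 0
  · rw [hz, mul_zero, mul_zero]
  · obtain ⟨h0, h1, h2⟩ := near_of_zCut3_ne_zero hε hz
    rw [triWeight_Rweight_eq_one hε hε1 h0 h1 h2, mul_one, ← rotDensityConst, ← mul_assoc,
      mul_inv_cancel₀ (rotDensityConst_pos hε).ne', one_mul]

end Pointwise
/-! ### The torus extraction with synthesis weights -/

section TorusSum

variable {ξ : Fin 3 → ℝ³} {n : ℝ³}

/-- `θ ↦ (R^θ_ξ ⊗ 1) Y` is continuous. [folklore] -/
theorem continuous_rotMat_rodRotEquiv {v : ℝ³} (hv : v ≠ 0) (Y : ℂ³) :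
    Continuous fun θ : ℝ => rotMat (rodRotEquiv hv θ) Y := by
  have h : ∀ θ : ℝ, rotMat (rodRotEquiv hv θ) Y =
      complexify (rodRot v θ (WithLp.toLp 2 fun j => (Y j).re)) +
        Complex.I • complexify (rodRot v θ (WithLp.toLp 2 fun j => (Y j).im)) := by
    intro θ
    rw [rotMat, complexifyCLM_eq_re_add_im]
    rfl
  simp_rw [h]
  have h1 : Continuous fun θ : ℝ => complexify (rodRot v θ (WithLp.toLp 2 fun j => (Y j).re)) :=
    FunctionSpaces.EuclideanSpace.continuous_complexify.comp (continuous_rodRot_angle _ _)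
  have h2 : Continuous fun θ : ℝ => complexify (rodRot v θ (WithLp.toLp 2 fun j => (Y j).im)) :=
    FunctionSpaces.EuclideanSpace.continuous_complexify.comp (continuous_rodRot_angle _ _)
  exact h1.add (h2.const_smul Complex.I)

/-- `Λ` is continuous in its three vector slots. [folklore] -/
theorem continuous_Λ_slots (a b : ℝ³) : Continuous fun v : ℂ³ × ℂ³ × ℂ³ => Λ a b v.1 v.2.1 v.2.2 := by
  unfold Λ
  have hc : Continuous fun x : ℂ³ × ℂ³ => cdot x.1 x.2 := contDiff_cdot.continuous
  exact ((hc.comp (continuous_fst.prodMk continuous_const)).mul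
    (hc.comp ((continuous_fst.comp continuous_snd).prodMk (continuous_snd.comp continuous_snd)))).add
    ((hc.comp ((continuous_fst.comp continuous_snd).prodMk continuous_const)).mul
      (hc.comp (continuous_fst.prodMk (continuous_snd.comp continuous_snd))))

/-- Level one of the extraction: the `θ₁`-integral. [cite: Tao2016AveragedNS, §3.9 p. 20] -/
theorem integral_level_fst (hξ : ξ 0 ≠ 0) (hn1 : ‖n‖ = 1) (hn : ⟪n, ξ 0⟫ = 0) (s : ℤˣ) (Y B C : ℂ³) :
    ∫ θ in (0 : ℝ)..2 * π, Complex.exp (-(Complex.I * ((s : ℤ) : ℂ) * (θ : ℂ))) *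
        Λ (ξ 0) (ξ 1) (rotMat (rodRotEquiv hξ θ) Y) B C =
      2 * (π : ℂ) * Λ (ξ 0) (ξ 1) (specProj (ξ 0) n s Y) B C := by
  simp_rw [Λ_rot_fst hξ hn1 hn]
  exact integral_extract_one s _ _

/-- Level two of the extraction: the `θ₂`-integral. [cite: Tao2016AveragedNS, §3.9 p. 20] -/
theorem integral_level_snd (hξ : ξ 1 ≠ 0) (hn1 : ‖n‖ = 1) (hn : ⟪n, ξ 1⟫ = 0) (s : ℤˣ) (A Y C : ℂ³) :
    ∫ θ in (0 : ℝ)..2 * π, Complex.exp (-(Complex.I * ((s : ℤ) : ℂ) * (θ : ℂ))) *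
        Λ (ξ 0) (ξ 1) A (rotMat (rodRotEquiv hξ θ) Y) C =
      2 * (π : ℂ) * Λ (ξ 0) (ξ 1) A (specProj (ξ 1) n s Y) C := by
  simp_rw [Λ_rot_snd hξ hn1 hn]
  exact integral_extract_one s _ _

/-- Level three of the extraction: the `θ₃`-integral. [cite: Tao2016AveragedNS, §3.9 p. 20] -/
theorem integral_level_thd (hξ : ξ 2 ≠ 0) (hn1 : ‖n‖ = 1) (hn : ⟪n, ξ 2⟫ = 0) (s : ℤˣ) (A B Y : ℂ³) :
    ∫ θ in (0 : ℝ)..2 * π, Complex.exp (-(Complex.I * ((s : ℤ) : ℂ) * (θ : ℂ))) *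
        Λ (ξ 0) (ξ 1) A B (rotMat (rodRotEquiv hξ θ) Y) =
      2 * (π : ℂ) * Λ (ξ 0) (ξ 1) A B (specProj (ξ 2) n s Y) := by
  simp_rw [Λ_rot_thd hξ hn1 hn]
  exact integral_extract_one s _ _

/-- **Torus extraction with synthesis weights** (linear combination of `integral_torus_extract`
over the eight sign patterns, the finite sum commuting with the iterated angular integrals by
continuity). [cite: Tao2016AveragedNS, §3.8–3.9 (3.21)–(3.23) pp. 19–20] -/
theorem integral_torus_extract_sum (hξ : ∀ j, ξ j ≠ 0) (hn1 : ‖n‖ = 1) (hn : ∀ j, ⟪n, ξ j⟫ = 0)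
    (A : (Fin 3 → ℤˣ) → ℂ) (Y : Fin 3 → ℂ³) :
    ∫ θ₃ in (0 : ℝ)..2 * π, ∫ θ₂ in (0 : ℝ)..2 * π, ∫ θ₁ in (0 : ℝ)..2 * π,
      ∑ σ : Fin 3 → ℤˣ, A σ * (Complex.exp (-(Complex.I * ((σ 2 : ℤ) : ℂ) * (θ₃ : ℂ))) *
        (Complex.exp (-(Complex.I * ((σ 1 : ℤ) : ℂ) * (θ₂ : ℂ))) *
          (Complex.exp (-(Complex.I * ((σ 0 : ℤ) : ℂ) * (θ₁ : ℂ))) *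
            Λ (ξ 0) (ξ 1) (rotMat (rodRotEquiv (hξ 0) θ₁) (Y 0)) (rotMat (rodRotEquiv (hξ 1) θ₂) (Y 1))
              (rotMat (rodRotEquiv (hξ 2) θ₃) (Y 2))))) =
      (2 * (π : ℂ)) ^ 3 * ∑ σ : Fin 3 → ℤˣ, A σ * Λ (ξ 0) (ξ 1) (specProj (ξ 0) n (σ 0) (Y 0))
        (specProj (ξ 1) n (σ 1) (Y 1)) (specProj (ξ 2) n (σ 2) (Y 2)) := by
  have hexp : ∀ (s : ℤˣ), Continuous fun θ : ℝ => Complex.exp (-(Complex.I * ((s : ℤ) : ℂ) * (θ : ℂ))) :=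
    fun s => by fun_prop
  have hΛc := continuous_Λ_slots (ξ 0) (ξ 1)
  -- level 1 (`θ₁`)
  have h1 : ∀ θ₂ θ₃ : ℝ, (∫ θ₁ in (0 : ℝ)..2 * π, ∑ σ : Fin 3 → ℤˣ, A σ *
      (Complex.exp (-(Complex.I * ((σ 2 : ℤ) : ℂ) * (θ₃ : ℂ))) *
        (Complex.exp (-(Complex.I * ((σ 1 : ℤ) : ℂ) * (θ₂ : ℂ))) *
          (Complex.exp (-(Complex.I * ((σ 0 : ℤ) : ℂ) * (θ₁ : ℂ))) *
            Λ (ξ 0) (ξ 1) (rotMat (rodRotEquiv (hξ 0) θ₁) (Y 0)) (rotMat (rodRotEquiv (hξ 1) θ₂) (Y 1))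
              (rotMat (rodRotEquiv (hξ 2) θ₃) (Y 2)))))) =
      ∑ σ : Fin 3 → ℤˣ, A σ * (Complex.exp (-(Complex.I * ((σ 2 : ℤ) : ℂ) * (θ₃ : ℂ))) *
        (Complex.exp (-(Complex.I * ((σ 1 : ℤ) : ℂ) * (θ₂ : ℂ))) *
          (2 * (π : ℂ) * Λ (ξ 0) (ξ 1) (specProj (ξ 0) n (σ 0) (Y 0)) (rotMat (rodRotEquiv (hξ 1) θ₂) (Y 1))
            (rotMat (rodRotEquiv (hξ 2) θ₃) (Y 2))))) := by
    intro θ₂ θ₃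
    rw [intervalIntegral.integral_finsetSum]
    · refine Finset.sum_congr rfl fun σ _ => ?_
      have e : ∀ θ₁ : ℝ, A σ * (Complex.exp (-(Complex.I * ((σ 2 : ℤ) : ℂ) * (θ₃ : ℂ))) *
          (Complex.exp (-(Complex.I * ((σ 1 : ℤ) : ℂ) * (θ₂ : ℂ))) *
            (Complex.exp (-(Complex.I * ((σ 0 : ℤ) : ℂ) * (θ₁ : ℂ))) *
              Λ (ξ 0) (ξ 1) (rotMat (rodRotEquiv (hξ 0) θ₁) (Y 0)) (rotMat (rodRotEquiv (hξ 1) θ₂) (Y 1))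
                (rotMat (rodRotEquiv (hξ 2) θ₃) (Y 2))))) =
          (A σ * (Complex.exp (-(Complex.I * ((σ 2 : ℤ) : ℂ) * (θ₃ : ℂ))) *
            Complex.exp (-(Complex.I * ((σ 1 : ℤ) : ℂ) * (θ₂ : ℂ))))) *
            (Complex.exp (-(Complex.I * ((σ 0 : ℤ) : ℂ) * (θ₁ : ℂ))) *
              Λ (ξ 0) (ξ 1) (rotMat (rodRotEquiv (hξ 0) θ₁) (Y 0)) (rotMat (rodRotEquiv (hξ 1) θ₂) (Y 1))
                (rotMat (rodRotEquiv (hξ 2) θ₃) (Y 2))) := fun θ₁ => by ring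
      simp_rw [e]
      rw [intervalIntegral.integral_const_mul, integral_level_fst (hξ 0) hn1 (hn 0)]
      ring
    · intro σ _
      have hL : Continuous fun θ₁ : ℝ => Λ (ξ 0) (ξ 1) (rotMat (rodRotEquiv (hξ 0) θ₁) (Y 0))
          (rotMat (rodRotEquiv (hξ 1) θ₂) (Y 1)) (rotMat (rodRotEquiv (hξ 2) θ₃) (Y 2)) := by
        have h := hΛc.comp ((continuous_rotMat_rodRotEquiv (hξ 0) (Y 0)).prodMk
          ((continuous_const (y := rotMat (rodRotEquiv (hξ 1) θ₂) (Y 1))).prodMk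
            (continuous_const (y := rotMat (rodRotEquiv (hξ 2) θ₃) (Y 2)))))
        exact h
      have hm := (hexp (σ 0)).mul hL
      have hm2 := (continuous_const (y := Complex.exp (-(Complex.I * ((σ 1 : ℤ) : ℂ) * (θ₂ : ℂ))))).mul hm
      have hm3 := (continuous_const (y := Complex.exp (-(Complex.I * ((σ 2 : ℤ) : ℂ) * (θ₃ : ℂ))))).mul hm2
      have hm4 := (continuous_const (y := A σ)).mul hm3
      exact hm4.intervalIntegrable _ _
  have s1 := intervalIntegral.integral_congr (μ := volume) (a := (0 : ℝ)) (b := 2 * π) fun θ₃ _ =>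
    intervalIntegral.integral_congr (μ := volume) (a := (0 : ℝ)) (b := 2 * π) fun θ₂ _ => h1 θ₂ θ₃
  rw [s1]
  -- level 2 (`θ₂`)
  have h2 : ∀ θ₃ : ℝ, (∫ θ₂ in (0 : ℝ)..2 * π, ∑ σ : Fin 3 → ℤˣ, A σ *
      (Complex.exp (-(Complex.I * ((σ 2 : ℤ) : ℂ) * (θ₃ : ℂ))) *
        (Complex.exp (-(Complex.I * ((σ 1 : ℤ) : ℂ) * (θ₂ : ℂ))) *
          (2 * (π : ℂ) * Λ (ξ 0) (ξ 1) (specProj (ξ 0) n (σ 0) (Y 0)) (rotMat (rodRotEquiv (hξ 1) θ₂) (Y 1))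
            (rotMat (rodRotEquiv (hξ 2) θ₃) (Y 2)))))) =
      ∑ σ : Fin 3 → ℤˣ, A σ * (Complex.exp (-(Complex.I * ((σ 2 : ℤ) : ℂ) * (θ₃ : ℂ))) *
        ((2 * (π : ℂ)) ^ 2 * Λ (ξ 0) (ξ 1) (specProj (ξ 0) n (σ 0) (Y 0)) (specProj (ξ 1) n (σ 1) (Y 1))
          (rotMat (rodRotEquiv (hξ 2) θ₃) (Y 2)))) := by
    intro θ₃
    rw [intervalIntegral.integral_finsetSum]
    · refine Finset.sum_congr rfl fun σ _ => ?_
      have e : ∀ θ₂ : ℝ, A σ * (Complex.exp (-(Complex.I * ((σ 2 : ℤ) : ℂ) * (θ₃ : ℂ))) *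
          (Complex.exp (-(Complex.I * ((σ 1 : ℤ) : ℂ) * (θ₂ : ℂ))) *
          (2 * (π : ℂ) * Λ (ξ 0) (ξ 1) (specProj (ξ 0) n (σ 0) (Y 0)) (rotMat (rodRotEquiv (hξ 1) θ₂) (Y 1))
            (rotMat (rodRotEquiv (hξ 2) θ₃) (Y 2))))) =
          (A σ * Complex.exp (-(Complex.I * ((σ 2 : ℤ) : ℂ) * (θ₃ : ℂ))) * (2 * (π : ℂ))) *
            (Complex.exp (-(Complex.I * ((σ 1 : ℤ) : ℂ) * (θ₂ : ℂ))) *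
              Λ (ξ 0) (ξ 1) (specProj (ξ 0) n (σ 0) (Y 0)) (rotMat (rodRotEquiv (hξ 1) θ₂) (Y 1))
                (rotMat (rodRotEquiv (hξ 2) θ₃) (Y 2))) := fun θ₂ => by ring
      simp_rw [e]
      rw [intervalIntegral.integral_const_mul, integral_level_snd (hξ 1) hn1 (hn 1)]
      ring
    · intro σ _
      have hL : Continuous fun θ₂ : ℝ => Λ (ξ 0) (ξ 1) (specProj (ξ 0) n (σ 0) (Y 0))
          (rotMat (rodRotEquiv (hξ 1) θ₂) (Y 1)) (rotMat (rodRotEquiv (hξ 2) θ₃) (Y 2)) := by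
        have h := hΛc.comp ((continuous_const (y := specProj (ξ 0) n (σ 0) (Y 0))).prodMk
          ((continuous_rotMat_rodRotEquiv (hξ 1) (Y 1)).prodMk
            (continuous_const (y := rotMat (rodRotEquiv (hξ 2) θ₃) (Y 2)))))
        exact h
      have hm := (continuous_const (y := 2 * (π : ℂ))).mul hL
      have hm1 := (hexp (σ 1)).mul hm
      have hm2 := (continuous_const (y := Complex.exp (-(Complex.I * ((σ 2 : ℤ) : ℂ) * (θ₃ : ℂ))))).mul hm1
      have hm3 := (continuous_const (y := A σ)).mul hm2
      exact hm3.intervalIntegrable _ _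
  have s2 := intervalIntegral.integral_congr (μ := volume) (a := (0 : ℝ)) (b := 2 * π) fun θ₃ _ => h2 θ₃
  rw [s2]
  -- level 3 (`θ₃`)
  rw [intervalIntegral.integral_finsetSum]
  · rw [Finset.mul_sum]
    refine Finset.sum_congr rfl fun σ _ => ?_
    have e : ∀ θ₃ : ℝ, A σ * (Complex.exp (-(Complex.I * ((σ 2 : ℤ) : ℂ) * (θ₃ : ℂ))) *
        ((2 * (π : ℂ)) ^ 2 * Λ (ξ 0) (ξ 1) (specProj (ξ 0) n (σ 0) (Y 0)) (specProj (ξ 1) n (σ 1) (Y 1))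
          (rotMat (rodRotEquiv (hξ 2) θ₃) (Y 2)))) =
        (A σ * (2 * (π : ℂ)) ^ 2) * (Complex.exp (-(Complex.I * ((σ 2 : ℤ) : ℂ) * (θ₃ : ℂ))) *
          Λ (ξ 0) (ξ 1) (specProj (ξ 0) n (σ 0) (Y 0)) (specProj (ξ 1) n (σ 1) (Y 1))
            (rotMat (rodRotEquiv (hξ 2) θ₃) (Y 2))) := fun θ₃ => by ring
    simp_rw [e]
    rw [intervalIntegral.integral_const_mul, integral_level_thd (hξ 2) hn1 (hn 2)]
    ring
  · intro σ _
    have hL : Continuous fun θ₃ : ℝ => Λ (ξ 0) (ξ 1) (specProj (ξ 0) n (σ 0) (Y 0))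
        (specProj (ξ 1) n (σ 1) (Y 1)) (rotMat (rodRotEquiv (hξ 2) θ₃) (Y 2)) := by
      have h := hΛc.comp ((continuous_const (y := specProj (ξ 0) n (σ 0) (Y 0))).prodMk
        ((continuous_const (y := specProj (ξ 1) n (σ 1) (Y 1))).prodMk (continuous_rotMat_rodRotEquiv (hξ 2) (Y 2))))
      exact h
    have hm := (continuous_const (y := (2 * (π : ℂ)) ^ 2)).mul hL
    have hm1 := (hexp (σ 2)).mul hm
    have hm2 := (continuous_const (y := A σ)).mul hm1
    exact hm2.intervalIntegrable _ _

end TorusSum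
/-! ### The fibre identity: the torus integral of the joint-weight integrand -/

section Fibre

variable {ε₀ : ℝ} (ψ : Fin 3 → 𝓢(ℝ³, ℂ³)) (X : Fin 3 → ℝ³ → ℂ³)

/-- The rotated coefficient `Yⱼ(q, ξ) = (ρ(qⱼ) ⊗ 1) Xⱼ(ρ(qⱼ)⁻¹ ξⱼ)` of `jointWeightAverage`. [cite: Tao2016AveragedNS, §3.5 (3.13) p. 17] -/
def Yrot (q : ℍ × ℍ × ℍ) (p : ℝ³ × ℝ³) (j : Fin 3) : ℂ³ :=
  rotMat (qrot (slotQ q j)) (X j ((qrot (slotQ q j)).symm (freq3 p j)))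

/-- The joint-weight integrand `F̃'(q, ξ) Λ_ξ(Y₁, Y₂, Y₃)` (without the weight `w`). [cite: Tao2016AveragedNS, §3.6 p. 18] -/
def coreIntegrand (hε : 0 < ε₀) (q : ℍ × ℍ × ℍ) (p : ℝ³ × ℝ³) : ℂ :=
  Fflat ψ hε q p * Λ (freq3 p 0) (freq3 p 1) (Yrot X q p 0) (Yrot X q p 1) (Yrot X q p 2)

/-- The separated product `∏ⱼ Xⱼ(ζⱼ) · P_{ζⱼ} \overline{ψ̂ⱼ(ζⱼ)}` on `(ℝ³)³`. [cite: Tao2016AveragedNS, §3.6 (3.15) p. 18] -/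
def hProd (ζ : ℝ³ × ℝ³ × ℝ³) : ℂ :=
  cdot (X 0 ζ.1) (projPerp ζ.1 (aVec ψ 0 ζ.1)) * cdot (X 1 ζ.2.1) (projPerp ζ.2.1 (aVec ψ 1 ζ.2.1)) *
    cdot (X 2 ζ.2.2) (projPerp ζ.2.2 (aVec ψ 2 ζ.2.2))

variable {ψ X}

/-- "Good" frequency pairs: the conclusions of the non-degeneracy (3.24) hold at `ξ`. [cite: Tao2016AveragedNS, §3.9 (3.24) p. 20] -/
structure GoodFreq (p : ℝ³ × ℝ³) : Prop where
  ne : ∀ j, freq3 p j ≠ 0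
  norm_n : ‖nVec p‖ = 1
  orth : ∀ j, ⟪nVec p, freq3 p j⟫ = 0
  lam : ∀ σ, lamP p σ ≠ 0

/-- On the support of the cut-offs the pair is good (`ε₀ ≤ 1/10`, `200 ε₀³ < δ`). [folklore] -/
theorem goodFreq_of_cutoffs (hε : 0 < ε₀) (hε1 : ε₀ ≤ 1 / 10) (hδ : 200 * ε₀ ^ 3 < ndDelta) {p : ℝ³ × ℝ³}
    (hR : pRad hε p ≠ 0) (hB : pFrame hε p ≠ 0) : GoodFreq p := by
  have hnear := near_xi0_of_cutoffs hε hε1 hR hB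
  have ht := eps_cube_pos hε
  obtain ⟨hne, -, hn1, hn, hlam⟩ := ndDelta_spec (freq3 p) (fun j => (hnear j).trans (by linarith)) (freq3_sum p)
  exact ⟨hne, hn1, hn, hlam⟩

/-! #### Behaviour of the data under the angle actions -/

/-- The slot quaternions of the acted triple. [folklore] -/
theorem slotQ_torus {u₁ u₂ u₃ : ℍ} (h₁ : ‖u₁‖ = 1) (h₂ : ‖u₂‖ = 1) (h₃ : ‖u₃‖ = 1) (q : ℍ × ℍ × ℍ) :
    slotQ (slotB h₁ (slotC h₂ (slotA h₃ q))) 0 = u₁ * slotQ q 0 ∧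
      slotQ (slotB h₁ (slotC h₂ (slotA h₃ q))) 1 = u₂ * slotQ q 1 ∧
        slotQ (slotB h₁ (slotC h₂ (slotA h₃ q))) 2 = u₃ * slotQ q 2 := ⟨rfl, rfl, rfl⟩

variable {p : ℝ³ × ℝ³} {q q' : ℍ × ℍ × ℍ} {θ : Fin 3 → ℝ}

/-- Hypothesis packaging: `q'` is `q` with slot `j` multiplied on the left by `e^{θⱼ uⱼ/2}`. [folklore] -/
def IsTorusImage (p : ℝ³ × ℝ³) (θ : Fin 3 → ℝ) (q q' : ℍ × ℍ × ℍ) : Prop :=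
  ∀ j, slotQ q' j = quatExp (udir (freq3 p j)) (θ j) * slotQ q j

/-- The three angles as a function on `Fin 3`. [folklore] -/
def ang3 (θ₁ θ₂ θ₃ : ℝ) : Fin 3 → ℝ := fun j => Fin.cases θ₁ (fun k => Fin.cases θ₂ (fun _ => θ₃) k) j

/-- `ang3 θ₁ θ₂ θ₃ 0 = θ₁`. [folklore] -/
@[simp] theorem ang3_zero (θ₁ θ₂ θ₃ : ℝ) : ang3 θ₁ θ₂ θ₃ 0 = θ₁ := rfl
/-- `ang3 θ₁ θ₂ θ₃ 1 = θ₂`. [folklore] -/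
@[simp] theorem ang3_one (θ₁ θ₂ θ₃ : ℝ) : ang3 θ₁ θ₂ θ₃ 1 = θ₂ := rfl
/-- `ang3 θ₁ θ₂ θ₃ 2 = θ₃`. [folklore] -/
@[simp] theorem ang3_two (θ₁ θ₂ θ₃ : ℝ) : ang3 θ₁ θ₂ θ₃ 2 = θ₃ := rfl

/-- The composite of the three slot actions is a torus image. [folklore] -/
theorem isTorusImage_slots (hp : ∀ j, freq3 p j ≠ 0) (θ₁ θ₂ θ₃ : ℝ) (q : ℍ × ℍ × ℍ) :
    IsTorusImage p (ang3 θ₁ θ₂ θ₃) q (slotB (norm_quatExp (norm_udir (hp 0)) θ₁)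
      (slotC (norm_quatExp (norm_udir (hp 1)) θ₂) (slotA (norm_quatExp (norm_udir (hp 2)) θ₃) q))) := by
  intro j
  fin_cases j <;> rfl

/-- The un-rotated frequencies are invariant. [folklore] -/
theorem zetaVec_torus (hp : ∀ j, freq3 p j ≠ 0) (h : IsTorusImage p θ q q') (j : Fin 3) :
    zetaVec q' p j = zetaVec q p j := by
  unfold zetaVec
  rw [h j, qrotFun_star_mul_of_fix _ (qrotFun_star_quatExp_self (hp j) (θ j))]

/-- The quaternion cut-off is invariant. [folklore] -/
theorem qCut_torus (hp : ∀ j, freq3 p j ≠ 0) (h : IsTorusImage p θ q q') : qCut q' = qCut q := by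
  have hn : ∀ j, ‖slotQ q' j‖ = ‖slotQ q j‖ := fun j => by
    rw [h j, norm_mul, norm_quatExp (norm_udir (hp j)), one_mul]
  have e0 := hn 0; have e1 := hn 1; have e2 := hn 2
  simp only [slotQ_zero, slotQ_one, slotQ_two] at e0 e1 e2
  unfold qCut
  rw [e0, e1, e2]

/-- The real cut-off is invariant. [folklore] -/
theorem realCut_torus (hε : 0 < ε₀) (hp : ∀ j, freq3 p j ≠ 0) (h : IsTorusImage p θ q q') :
    realCut hε q' p = realCut hε q p := by
  unfold realCut zCut
  rw [qCut_torus hp h, zetaVec_torus hp h 0, zetaVec_torus hp h 1, zetaVec_torus hp h 2]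

/-- The rotated coefficients rotate: `Yⱼ(q') = (R^{θⱼ}_{ξⱼ} ⊗ 1) Yⱼ(q)`. [cite: Tao2016AveragedNS, §3.7 footnote 6 p. 19] -/
theorem Yrot_torus (hp : ∀ j, freq3 p j ≠ 0) (h : IsTorusImage p θ q q') (hq : ∀ j, slotQ q j ≠ 0) (j : Fin 3) :
    Yrot X q' p j = rotMat (rodRotEquiv (hp j) (θ j)) (Yrot X q p j) := by
  have he : quatExp (udir (freq3 p j)) (θ j) ≠ 0 := quatExp_ne_zero (norm_udir (hp j)) _
  have hq' : slotQ q' j ≠ 0 := by rw [h j]; exact mul_ne_zero he (hq j)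
  unfold Yrot
  have harg : (qrot (slotQ q' j)).symm (freq3 p j) = (qrot (slotQ q j)).symm (freq3 p j) := by
    rw [qrot_symm_apply, qrot_symm_apply, qrot_apply (star_ne_zero.mpr hq'), qrot_apply (star_ne_zero.mpr (hq j)),
      h j, qrotFun_star_mul_of_fix _ (qrotFun_star_quatExp_self (hp j) (θ j))]
  rw [harg, h j, rotMat_qrot_mul he (hq j), rotMat_qrot_quatExp (hp j)]

/-- The projected profile vectors rotate: `cⱼ(q') = (R^{θⱼ}_{ξⱼ} ⊗ 1) cⱼ(q)`. [cite: Tao2016AveragedNS, §3.7 footnote 6 p. 19] -/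
theorem cVec_torus (hp : ∀ j, freq3 p j ≠ 0) (h : IsTorusImage p θ q q') (hq : ∀ j, slotQ q j ≠ 0) (j : Fin 3) :
    cVec ψ q' p j = rotMat (rodRotEquiv (hp j) (θ j)) (cVec ψ q p j) := by
  have he : quatExp (udir (freq3 p j)) (θ j) ≠ 0 := quatExp_ne_zero (norm_udir (hp j)) _
  unfold cVec
  rw [zetaVec_torus hp h j, h j, rotMat_qrot_mul he (hq j), rotMat_qrot_quatExp (hp j)]

/-- **The synthesis sum acquires the characters**: `S(q', ξ) = Σ_σ λ_σ⁻¹ ∏ⱼ e^{-iσⱼθⱼ} (W^{σⱼ}ⱼ · cⱼ(q))`. [cite: Tao2016AveragedNS, §3.8 (3.22)–(3.23) p. 19] -/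
theorem Ssum_torus (hg : GoodFreq p) (h : IsTorusImage p θ q q') (hq : ∀ j, slotQ q j ≠ 0) :
    Ssum ψ q' p = ∑ σ : Fin 3 → ℤˣ, (lamP p σ)⁻¹ *
      ∏ j, (Complex.exp (-(Complex.I * ((σ j : ℤ) : ℂ) * ((θ j : ℝ) : ℂ))) * cdot (Wvec p j (σ j)) (cVec ψ q p j)) := by
  unfold Ssum
  refine Finset.sum_congr rfl fun σ _ => ?_
  congr 1
  refine Finset.prod_congr rfl fun j _ => ?_
  rw [cVec_torus hg.ne h hq j, Wvec, cdot_frameW_rotMat_rodRotEquiv (hg.ne j) (hg.orth j)]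

/-- **The integrand along the torus orbit** (all `qⱼ ≠ 0`, `ξ` good):
`F̃'(q') Λ(Y(q')) = realCut(q) Σ_σ [λ_σ⁻¹ ∏ⱼ W^{σⱼ}·cⱼ(q)] e^{-iσ₃θ₃}(e^{-iσ₂θ₂}(e^{-iσ₁θ₁} Λ(R^{θ₁}Y₁, R^{θ₂}Y₂, R^{θ₃}Y₃)))`. [cite: Tao2016AveragedNS, §3.8 p. 19] -/
theorem coreIntegrand_torus (hε : 0 < ε₀) (hg : GoodFreq p) (hq : ∀ j, slotQ q j ≠ 0) (θ₁ θ₂ θ₃ : ℝ) :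
    coreIntegrand ψ X hε (slotB (norm_quatExp (norm_udir (hg.ne 0)) θ₁)
        (slotC (norm_quatExp (norm_udir (hg.ne 1)) θ₂) (slotA (norm_quatExp (norm_udir (hg.ne 2)) θ₃) q))) p =
      ((realCut hε q p : ℝ) : ℂ) *
        ∑ σ : Fin 3 → ℤˣ, ((lamP p σ)⁻¹ * ∏ j, cdot (Wvec p j (σ j)) (cVec ψ q p j)) *
          (Complex.exp (-(Complex.I * ((σ 2 : ℤ) : ℂ) * (θ₃ : ℂ))) *
            (Complex.exp (-(Complex.I * ((σ 1 : ℤ) : ℂ) * (θ₂ : ℂ))) *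
              (Complex.exp (-(Complex.I * ((σ 0 : ℤ) : ℂ) * (θ₁ : ℂ))) *
                Λ (freq3 p 0) (freq3 p 1) (rotMat (rodRotEquiv (hg.ne 0) θ₁) (Yrot X q p 0))
                  (rotMat (rodRotEquiv (hg.ne 1) θ₂) (Yrot X q p 1))
                  (rotMat (rodRotEquiv (hg.ne 2) θ₃) (Yrot X q p 2))))) := by
  have h := isTorusImage_slots hg.ne θ₁ θ₂ θ₃ q
  unfold coreIntegrand Fflat
  rw [realCut_torus hε hg.ne h, Ssum_torus hg h hq, Yrot_torus hg.ne h hq 0, Yrot_torus hg.ne h hq 1,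
    Yrot_torus hg.ne h hq 2, mul_assoc, Finset.sum_mul]
  simp only [ang3_zero, ang3_one, ang3_two]
  congr 1
  refine Finset.sum_congr rfl fun σ _ => ?_
  rw [Fin.prod_univ_three, Fin.prod_univ_three]
  simp only [ang3_zero, ang3_one, ang3_two]
  ring

/-- **The profile vectors are orthogonal to their frequencies**: `cⱼ(q) · (ξⱼ/|ξⱼ| ⊗ 1) = 0`. [cite: Tao2016AveragedNS, §3.5 p. 17] -/
theorem cdot_cVec_axis (hp : ∀ j, freq3 p j ≠ 0) (hq : ∀ j, slotQ q j ≠ 0) (j : Fin 3) :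
    cdot (cVec ψ q p j) (complexify (udir (freq3 p j))) = 0 := by
  have hζ : zetaVec q p j ≠ 0 := by
    intro h0
    have : ‖zetaVec q p j‖ = ‖freq3 p j‖ := by unfold zetaVec; rw [norm_qrotFun (star_ne_zero.mpr (hq j))]
    rw [h0, norm_zero] at this
    exact hp j (norm_eq_zero.mp this.symm)
  have hax : complexify (udir (freq3 p j)) = rotMat (qrot (slotQ q j)) (complexify (udir (zetaVec q p j))) := by
    rw [rotMat_complexify, qrot_apply (hq j), ← udir_qrotFun (hq j)]
    unfold zetaVec
    rw [qrotFun_self_star (hq j)]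
  unfold cVec
  rw [hax, cdot_complexifyCLM, projPerp, cdot_sub_left, cdot_smul_left, cdot_complexify,
    real_inner_self_eq_norm_sq, norm_udir hζ]
  push_cast
  ring

/-- `Yⱼ(q) · cⱼ(q) = Xⱼ(ζⱼ) · P_{ζⱼ} aⱼ(ζⱼ)` (rotations preserve `cdot`). [folklore] -/
theorem cdot_Yrot_cVec (hq : ∀ j, slotQ q j ≠ 0) (j : Fin 3) :
    cdot (Yrot X q p j) (cVec ψ q p j) = cdot (X j (zetaVec q p j)) (projPerp (zetaVec q p j) (aVec ψ j (zetaVec q p j))) := by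
  unfold Yrot cVec
  rw [cdot_complexifyCLM, qrot_symm_apply, qrot_apply (star_ne_zero.mpr (hq j))]
  rfl

/-- **The fibre identity** (Tao 2016, §3.7–3.9 in quaternion coordinates): for good `ξ` and
every `q`, the torus integral of the joint-weight integrand is
`(2π)³ realCut(q, ξ) ∏ⱼ Xⱼ(ζⱼ) · P_{ζⱼ} \overline{ψ̂ⱼ(ζⱼ)}`. [cite: Tao2016AveragedNS, §3.7–3.9 (3.20)–(3.24) pp. 19–20] -/
theorem torus_integral_core (hε : 0 < ε₀) (hg : GoodFreq p) (q : ℍ × ℍ × ℍ) :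
    ∫ θ₃ in (0 : ℝ)..2 * π, ∫ θ₂ in (0 : ℝ)..2 * π, ∫ θ₁ in (0 : ℝ)..2 * π,
      coreIntegrand ψ X hε (slotB (norm_quatExp (norm_udir (hg.ne 0)) θ₁)
        (slotC (norm_quatExp (norm_udir (hg.ne 1)) θ₂) (slotA (norm_quatExp (norm_udir (hg.ne 2)) θ₃) q))) p =
      (2 * (π : ℂ)) ^ 3 * (((realCut hε q p : ℝ) : ℂ) * hProd ψ X (rotFreq (q, p))) := by
  by_cases hq : ∀ j, slotQ q j ≠ 0
  · -- the orbit computation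
    have hpt : ∀ θ₁ θ₂ θ₃ : ℝ, coreIntegrand ψ X hε (slotB (norm_quatExp (norm_udir (hg.ne 0)) θ₁)
        (slotC (norm_quatExp (norm_udir (hg.ne 1)) θ₂) (slotA (norm_quatExp (norm_udir (hg.ne 2)) θ₃) q))) p =
        ((realCut hε q p : ℝ) : ℂ) *
          ∑ σ : Fin 3 → ℤˣ, ((lamP p σ)⁻¹ * ∏ j, cdot (Wvec p j (σ j)) (cVec ψ q p j)) *
            (Complex.exp (-(Complex.I * ((σ 2 : ℤ) : ℂ) * (θ₃ : ℂ))) *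
              (Complex.exp (-(Complex.I * ((σ 1 : ℤ) : ℂ) * (θ₂ : ℂ))) *
                (Complex.exp (-(Complex.I * ((σ 0 : ℤ) : ℂ) * (θ₁ : ℂ))) *
                  Λ (freq3 p 0) (freq3 p 1) (rotMat (rodRotEquiv (hg.ne 0) θ₁) (Yrot X q p 0))
                    (rotMat (rodRotEquiv (hg.ne 1) θ₂) (Yrot X q p 1))
                    (rotMat (rodRotEquiv (hg.ne 2) θ₃) (Yrot X q p 2))))) := by
      intro θ₁ θ₂ θ₃
      exact coreIntegrand_torus hε hg hq θ₁ θ₂ θ₃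
    have s1 := intervalIntegral.integral_congr (μ := volume) (a := (0 : ℝ)) (b := 2 * π) fun θ₃ _ =>
      intervalIntegral.integral_congr (μ := volume) (a := (0 : ℝ)) (b := 2 * π) fun θ₂ _ =>
        intervalIntegral.integral_congr (μ := volume) (a := (0 : ℝ)) (b := 2 * π) fun θ₁ _ => hpt θ₁ θ₂ θ₃
    rw [s1]
    simp only [intervalIntegral.integral_const_mul]
    have hext := integral_torus_extract_sum (ξ := freq3 p) (n := nVec p) hg.ne hg.norm_n hg.orth
      (fun σ => (lamP p σ)⁻¹ * ∏ j, cdot (Wvec p j (σ j)) (cVec ψ q p j)) (Yrot X q p)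
    rw [hext]
    have hsyn := fibre_synthesis (ξ := freq3 p) (n := nVec p) hg.ne hg.norm_n hg.orth hg.lam (Yrot X q p) (cVec ψ q p)
      (cdot_cVec_axis hg.ne hq)
    have hsyn' : ∑ σ : Fin 3 → ℤˣ, (lamP p σ)⁻¹ * (∏ j, cdot (Wvec p j (σ j)) (cVec ψ q p j)) *
        Λ (freq3 p 0) (freq3 p 1) (specProj (freq3 p 0) (nVec p) (σ 0) (Yrot X q p 0))
          (specProj (freq3 p 1) (nVec p) (σ 1) (Yrot X q p 1))
          (specProj (freq3 p 2) (nVec p) (σ 2) (Yrot X q p 2)) = ∏ j, cdot (Yrot X q p j) (cVec ψ q p j) := hsyn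
    rw [hsyn', Fin.prod_univ_three, cdot_Yrot_cVec hq, cdot_Yrot_cVec hq, cdot_Yrot_cVec hq]
    unfold hProd
    rw [rotFreq_eq]
    ring
  · -- some `qⱼ = 0`: both sides vanish
    simp only [not_forall, not_not] at hq
    obtain ⟨j, hj⟩ := hq
    have hzero : ∀ θ₁ θ₂ θ₃ : ℝ, coreIntegrand ψ X hε (slotB (norm_quatExp (norm_udir (hg.ne 0)) θ₁)
        (slotC (norm_quatExp (norm_udir (hg.ne 1)) θ₂) (slotA (norm_quatExp (norm_udir (hg.ne 2)) θ₃) q))) p = 0 := by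
      intro θ₁ θ₂ θ₃
      unfold coreIntegrand Fflat
      rw [realCut_torus hε hg.ne (isTorusImage_slots hg.ne θ₁ θ₂ θ₃ q), realCut,
        qCut_eq_zero_of_norm_lt (j := j) (by rw [hj, norm_zero]; norm_num)]
      simp only [zero_mul, Complex.ofReal_zero]
    have s1 := intervalIntegral.integral_congr (μ := volume) (a := (0 : ℝ)) (b := 2 * π) fun θ₃ _ =>
      intervalIntegral.integral_congr (μ := volume) (a := (0 : ℝ)) (b := 2 * π) fun θ₂ _ =>
        intervalIntegral.integral_congr (μ := volume) (a := (0 : ℝ)) (b := 2 * π) fun θ₁ _ => hzero θ₁ θ₂ θ₃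
    rw [s1]
    rw [realCut, qCut_eq_zero_of_norm_lt (j := j) (by rw [hj, norm_zero]; norm_num)]
    simp

end Fibre
/-! ### Measurability and bounds -/

section Bounds

variable {ε₀ : ℝ} (ψ : Fin 3 → 𝓢(ℝ³, ℂ³)) (X : Fin 3 → ℝ³ → ℂ³)

/-- `(q, v) ↦ ρ(q) v` (with `ρ(0) = 1`) is jointly measurable. [folklore] -/
theorem measurable_qrot_uncurry : Measurable fun y : ℍ × ℝ³ => qrot y.1 y.2 := by
  classical
  have h : (fun y : ℍ × ℝ³ => qrot y.1 y.2) = fun y => if y.1 = 0 then y.2 else qrotFun y.1 y.2 := by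
    funext y
    by_cases hy : y.1 = 0
    · rw [if_pos hy, hy, qrot_zero_apply]
    · rw [if_neg hy, qrot_apply hy]
  rw [h]
  exact Measurable.ite (measurableSet_eq_fun measurable_fst measurable_const) measurable_snd measurable_qrotFun_uncurry

/-- `ρ(0) ⊗ 1 = 1`. [folklore] -/
theorem rotMat_qrot_zero (z : ℂ³) : rotMat (qrot 0) z = z := by
  have : qrot 0 = LinearIsometryEquiv.refl ℝ ℝ³ := by unfold qrot; rw [dif_pos rfl]
  rw [this, rotMat_refl_apply]

/-- `(q, z) ↦ (ρ(q) ⊗ 1) z` is jointly measurable. [folklore] -/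
theorem measurable_rotMat_qrot_uncurry : Measurable fun y : ℍ × ℂ³ => rotMat (qrot y.1) y.2 := by
  classical
  have h : (fun y : ℍ × ℂ³ => rotMat (qrot y.1) y.2) = fun y => if y.1 = 0 then y.2 else
      complexify (qrotFun y.1 (WithLp.toLp 2 fun j => (y.2 j).re)) +
        Complex.I • complexify (qrotFun y.1 (WithLp.toLp 2 fun j => (y.2 j).im)) := by
    funext y
    by_cases hy : y.1 = 0
    · rw [if_pos hy, hy, rotMat_qrot_zero]
    · rw [if_neg hy, rotMat_qrot_eq hy]
  rw [h]
  refine Measurable.ite (measurableSet_eq_fun measurable_fst measurable_const) measurable_snd ?_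
  have hc := (FunctionSpaces.EuclideanSpace.continuous_complexify (ι := Fin 3)).measurable
  have h1 : Measurable fun y : ℍ × ℂ³ => complexify (qrotFun y.1 (WithLp.toLp 2 fun j => (y.2 j).re)) := by
    have h := hc.comp (measurable_qrotFun_uncurry.comp (measurable_fst.prodMk
      (contDiff_reVec3.continuous.measurable.comp (measurable_snd (α := ℍ) (β := ℂ³)))))
    exact h
  have h2 : Measurable fun y : ℍ × ℂ³ => complexify (qrotFun y.1 (WithLp.toLp 2 fun j => (y.2 j).im)) := by
    have h := hc.comp (measurable_qrotFun_uncurry.comp (measurable_fst.prodMk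
      (contDiff_imVec3.continuous.measurable.comp (measurable_snd (α := ℍ) (β := ℂ³)))))
    exact h
  exact h1.add (h2.const_smul Complex.I)

variable {X}

/-- The rotated coefficients are jointly measurable (for measurable `Xⱼ`). [folklore] -/
theorem measurable_Yrot (hX : ∀ j, Measurable (X j)) (j : Fin 3) :
    Measurable fun x : (ℍ × ℍ × ℍ) × (ℝ³ × ℝ³) => Yrot X x.1 x.2 j := by
  unfold Yrot
  have hs : Measurable fun x : (ℍ × ℍ × ℍ) × (ℝ³ × ℝ³) => slotQ x.1 j :=
    (contDiff_slotQ j).continuous.measurable.comp measurable_fst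
  have hf : Measurable fun x : (ℍ × ℍ × ℍ) × (ℝ³ × ℝ³) => freq3 x.2 j :=
    (contDiff_freq3_apply j).continuous.measurable.comp measurable_snd
  have harg : Measurable fun x : (ℍ × ℍ × ℍ) × (ℝ³ × ℝ³) => (qrot (slotQ x.1 j)).symm (freq3 x.2 j) := by
    have e : (fun x : (ℍ × ℍ × ℍ) × (ℝ³ × ℝ³) => (qrot (slotQ x.1 j)).symm (freq3 x.2 j)) =
        fun x => qrot (star (slotQ x.1 j)) (freq3 x.2 j) := by
      funext x; exact qrot_symm_apply _ _
    rw [e]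
    have h := measurable_qrot_uncurry.comp ((continuous_star.measurable.comp hs).prodMk hf)
    exact h
  have hXarg : Measurable fun x : (ℍ × ℍ × ℍ) × (ℝ³ × ℝ³) => X j ((qrot (slotQ x.1 j)).symm (freq3 x.2 j)) :=
    (hX j).comp harg
  have h := measurable_rotMat_qrot_uncurry.comp (hs.prodMk hXarg)
  exact h

/-- Tao's weight `w` is measurable. [folklore] -/
theorem measurable_singleScaleWeight (ε₀ : ℝ) : Measurable (singleScaleWeight ε₀) := by
  unfold singleScaleWeight eta freqCutoff
  have hc : Measurable (freqCutoffBump : ℝ → ℝ) := freqCutoffBump.continuous.measurable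
  have h1 : Measurable fun p : ℝ³ × ℝ³ => ‖p.1‖ := measurable_fst.norm
  have h2 : Measurable fun p : ℝ³ × ℝ³ => ‖p.2‖ := measurable_snd.norm
  have h3 : Measurable fun p : ℝ³ × ℝ³ => ‖-p.1 - p.2‖ := (measurable_fst.neg.sub measurable_snd).norm
  exact (hc.comp ((measurable_fst.sub measurable_const).norm.div_const _)).mul
    ((hc.comp (((h2.div h1).sub measurable_const).div_const _)).mul
      (hc.comp (((h3.div h1).sub measurable_const).div_const _)))

/-- `|w| ≤ 1`. [folklore] -/
theorem abs_singleScaleWeight_le_one (ε₀ : ℝ) (p : ℝ³ × ℝ³) : |singleScaleWeight ε₀ p| ≤ 1 := by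
  unfold singleScaleWeight eta
  rw [abs_mul, abs_mul, abs_of_nonneg (freqCutoff_nonneg _), abs_of_nonneg (freqCutoff_nonneg _),
    abs_of_nonneg (freqCutoff_nonneg _)]
  exact mul_le_one₀ (freqCutoff_le_one _) (mul_nonneg (freqCutoff_nonneg _) (freqCutoff_nonneg _))
    (mul_le_one₀ (freqCutoff_le_one _) (freqCutoff_nonneg _) (freqCutoff_le_one _))

/-- `|Λ_{ab}(X, Y, Z)| ≤ (|b| + |a|) |X| |Y| |Z|` (cf. the tree's `norm_Λ_le`, stated differently). [folklore] -/
theorem norm_Λ_le' (a b : ℝ³) (x y z : ℂ³) : ‖Λ a b x y z‖ ≤ (‖b‖ + ‖a‖) * (‖x‖ * ‖y‖ * ‖z‖) := by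
  unfold Λ
  have h1 := norm_cdot_le x (complexify b)
  have h2 := norm_cdot_le y z
  have h3 := norm_cdot_le y (complexify a)
  have h4 := norm_cdot_le x z
  rw [FunctionSpaces.EuclideanSpace.norm_complexify] at h1 h3
  calc _ ≤ ‖cdot x (complexify b) * cdot y z‖ + ‖cdot y (complexify a) * cdot x z‖ := norm_add_le _ _
    _ = ‖cdot x (complexify b)‖ * ‖cdot y z‖ + ‖cdot y (complexify a)‖ * ‖cdot x z‖ := by rw [norm_mul, norm_mul]
    _ ≤ ‖x‖ * ‖b‖ * (‖y‖ * ‖z‖) + ‖y‖ * ‖a‖ * (‖x‖ * ‖z‖) := by gcongr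
    _ = (‖b‖ + ‖a‖) * (‖x‖ * ‖y‖ * ‖z‖) := by ring

/-- **The disintegration weight in real terms**: `(rotWeight x).toReal = qDensity · qCut · pRad · pFrame`. [folklore] -/
theorem rotWeight_toReal (hε : 0 < ε₀) (x : (ℍ × ℍ × ℍ) × (ℝ³ × ℝ³)) :
    (rotWeight gTotal (Rweight hε) (Bweight hε) x).toReal = qDensity x.1 * qCut x.1 * pRad hε x.2 * pFrame hε x.2 := by
  have hg : ∀ t : ℝ, 0 ≤ gBump t * gBump2 (t ^ 2) := fun t => mul_nonneg gBump.nonneg gBump2.nonneg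
  have hR : 0 ≤ pRad hε x.2 := by
    unfold pRad
    exact mul_nonneg (by positivity) (mul_nonneg (mul_nonneg (kappaBump hε 0).nonneg (kappaBump hε 1).nonneg)
      (kappaBump hε 2).nonneg)
  have hB : 0 ≤ pFrame hε x.2 := mul_nonneg (dirBump hε).nonneg (normalBump hε).nonneg
  unfold rotWeight frameWeight gTotal
  have eR : Rweight hε ‖x.2.1‖ ‖x.2.2‖ ‖-x.2.1 - x.2.2‖ = ENNReal.ofReal (pRad hε x.2) := rfl
  have eB : Bweight hε (udir (-x.2.1 - x.2.2)) (udir (cross x.2.1 x.2.2)) = ENNReal.ofReal (pFrame hε x.2) := rfl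
  rw [eR, eB]
  simp only [ENNReal.toReal_mul, ENNReal.toReal_ofReal (hg _), ENNReal.toReal_ofReal hR, ENNReal.toReal_ofReal hB]
  unfold qDensity qCut
  ring

/-- The disintegration weight is finite. [folklore] -/
theorem rotWeight_lt_top (hε : 0 < ε₀) (x : (ℍ × ℍ × ℍ) × (ℝ³ × ℝ³)) :
    rotWeight gTotal (Rweight hε) (Bweight hε) x < ⊤ := by
  unfold rotWeight frameWeight gTotal Rweight Bweight
  exact ENNReal.mul_lt_top (ENNReal.mul_lt_top (ENNReal.mul_lt_top ENNReal.ofReal_lt_top ENNReal.ofReal_lt_top)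
    ENNReal.ofReal_lt_top) (ENNReal.mul_lt_top ENNReal.ofReal_lt_top ENNReal.ofReal_lt_top)

/-- Measurability of the magnitude weight. [folklore] -/
theorem measurable_Rweight (hε : 0 < ε₀) : Measurable fun r : ℝ × ℝ × ℝ => Rweight hε r.1 r.2.1 r.2.2 := by
  unfold Rweight
  refine ENNReal.measurable_ofReal.comp ?_
  have h1 : Measurable fun r : ℝ × ℝ × ℝ => r.1 := measurable_fst
  have h2 : Measurable fun r : ℝ × ℝ × ℝ => r.2.1 := measurable_fst.comp measurable_snd
  have h3 : Measurable fun r : ℝ × ℝ × ℝ => r.2.2 := measurable_snd.comp measurable_snd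
  exact ((h1.mul h2).mul h3).mul ((((kappaBump hε 0).continuous.measurable.comp h1).mul
    ((kappaBump hε 1).continuous.measurable.comp h2)).mul ((kappaBump hε 2).continuous.measurable.comp h3))

/-- The disintegration weight is measurable. [folklore] -/
theorem measurable_rotWeight' (hε : 0 < ε₀) : Measurable (rotWeight gTotal (Rweight hε) (Bweight hε)) :=
  measurable_rotWeight measurable_gTotal (measurable_Rweight hε) (measurable_Bweight hε)

/-- **The disintegration applied to a separated product**: for measurable `hⱼ ≥ 0`,
`∫ rotWeight(x) ∏ⱼ hⱼ(ζⱼ(x)) dx ≤ C ∏ⱼ ∫ hⱼ`. [cite: Tao2016AveragedNS, §3.6 p. 18] -/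
theorem lintegral_rotWeight_prod_le (hε : 0 < ε₀) {h : Fin 3 → ℝ³ → ℝ≥0∞} (hh : ∀ j, Measurable (h j)) :
    ∫⁻ x : (ℍ × ℍ × ℍ) × (ℝ³ × ℝ³), rotWeight gTotal (Rweight hε) (Bweight hε) x *
        (h 0 (zetaVec x.1 x.2 0) * h 1 (zetaVec x.1 x.2 1) * h 2 (zetaVec x.1 x.2 2)) ≤
      rotDensityConstE hε * ((∫⁻ v, h 0 v) * ((∫⁻ v, h 1 v) * ∫⁻ v, h 2 v)) := by
  have hH : Measurable fun ζ : ℝ³ × ℝ³ × ℝ³ => h 0 ζ.1 * h 1 ζ.2.1 * h 2 ζ.2.2 :=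
    (((hh 0).comp measurable_fst).mul ((hh 1).comp (measurable_fst.comp measurable_snd))).mul
      ((hh 2).comp (measurable_snd.comp measurable_snd))
  have hD := lintegral_rotation_disintegration gTotal measurable_gTotal (Rweight hε) (measurable_Rweight hε)
    (Bweight hε) (measurable_Bweight hε) _ hH
  have hlhs : ∫⁻ x : (ℍ × ℍ × ℍ) × (ℝ³ × ℝ³), rotWeight gTotal (Rweight hε) (Bweight hε) x *
      (h 0 (zetaVec x.1 x.2 0) * h 1 (zetaVec x.1 x.2 1) * h 2 (zetaVec x.1 x.2 2)) =
      ∫⁻ x : (ℍ × ℍ × ℍ) × (ℝ³ × ℝ³), gTotal ‖x.1.1‖ * gTotal ‖x.1.2.1‖ * gTotal ‖x.1.2.2‖ *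
        frameWeight (Rweight hε) (Bweight hε) x.2 *
          (h 0 (qrotFun (star x.1.2.1) x.2.1) * h 1 (qrotFun (star x.1.2.2) x.2.2) *
            h 2 (qrotFun (star x.1.1) (-x.2.1 - x.2.2))) := rfl
  rw [hlhs, hD, rotDensityConstE]
  gcongr
  calc ∫⁻ ζ : ℝ³ × ℝ³ × ℝ³, triWeight (Rweight hε) ζ * (h 0 ζ.1 * h 1 ζ.2.1 * h 2 ζ.2.2)
      ≤ ∫⁻ ζ : ℝ³ × ℝ³ × ℝ³, h 0 ζ.1 * (h 1 ζ.2.1 * h 2 ζ.2.2) := by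
        refine lintegral_mono fun ζ => ?_
        calc _ ≤ 1 * (h 0 ζ.1 * h 1 ζ.2.1 * h 2 ζ.2.2) := by gcongr; exact triWeight_Rweight_le_one hε ζ
          _ = _ := by ring
    _ = ∫⁻ ζ : ℝ³ × ℝ³ × ℝ³, h 0 ζ.1 * (h 1 ζ.2.1 * h 2 ζ.2.2) ∂((volume : Measure ℝ³).prod
          (volume : Measure (ℝ³ × ℝ³))) := by rw [← Measure.volume_eq_prod]
    _ = (∫⁻ v, h 0 v) * ∫⁻ w : ℝ³ × ℝ³, h 1 w.1 * h 2 w.2 :=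
        lintegral_prod_mul (hh 0).aemeasurable (((hh 1).comp measurable_fst).mul ((hh 2).comp measurable_snd)).aemeasurable
    _ = (∫⁻ v, h 0 v) * ∫⁻ w : ℝ³ × ℝ³, h 1 w.1 * h 2 w.2 ∂((volume : Measure ℝ³).prod (volume : Measure ℝ³)) := by
        rw [← Measure.volume_eq_prod]
    _ = (∫⁻ v, h 0 v) * ((∫⁻ v, h 1 v) * ∫⁻ v, h 2 v) := by
        rw [lintegral_prod_mul (hh 1).aemeasurable (hh 2).aemeasurable]

/-- The set carrying the real cut-off: `|qⱼ| ∈ [1/2, 2]` and `|ξⱼ - ξⱼ⁰| ≤ 100ε₀³`; compact and good. [folklore] -/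
def cutSupport (ε₀ : ℝ) : Set ((ℍ × ℍ × ℍ) × (ℝ³ × ℝ³)) :=
  {x | (∀ j, 1 / 2 ≤ ‖slotQ x.1 j‖ ∧ ‖slotQ x.1 j‖ ≤ 2) ∧ ∀ j, ‖freq3 x.2 j - xi0 j‖ ≤ 100 * ε₀ ^ 3}

/-- `cutSupport` is compact. [folklore] -/
theorem isCompact_cutSupport (ε₀ : ℝ) : IsCompact (cutSupport ε₀) := by
  have hclosed : IsClosed (cutSupport ε₀) := by
    have h1 : ∀ j, IsClosed {x : (ℍ × ℍ × ℍ) × (ℝ³ × ℝ³) | 1 / 2 ≤ ‖slotQ x.1 j‖ ∧ ‖slotQ x.1 j‖ ≤ 2} := by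
      intro j
      have hc : Continuous fun x : (ℍ × ℍ × ℍ) × (ℝ³ × ℝ³) => ‖slotQ x.1 j‖ :=
        ((contDiff_slotQ j).continuous.comp continuous_fst).norm
      exact (isClosed_le continuous_const hc).inter (isClosed_le hc continuous_const)
    have h2 : ∀ j, IsClosed {x : (ℍ × ℍ × ℍ) × (ℝ³ × ℝ³) | ‖freq3 x.2 j - xi0 j‖ ≤ 100 * ε₀ ^ 3} := fun j =>
      isClosed_le ((((contDiff_freq3_apply j).continuous.comp continuous_snd).sub continuous_const).norm)
        continuous_const
    have : cutSupport ε₀ = (⋂ j, {x | 1 / 2 ≤ ‖slotQ x.1 j‖ ∧ ‖slotQ x.1 j‖ ≤ 2}) ∩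
        ⋂ j, {x | ‖freq3 x.2 j - xi0 j‖ ≤ 100 * ε₀ ^ 3} := by
      ext x; simp [cutSupport]
    rw [this]
    exact (isClosed_iInter h1).inter (isClosed_iInter h2)
  refine Metric.isCompact_of_isClosed_isBounded hclosed ?_
  refine (Metric.isBounded_closedBall (x := (0 : (ℍ × ℍ × ℍ) × (ℝ³ × ℝ³))) (r := 2 + 3 + 100 * |ε₀| ^ 3)).subset ?_
  intro x hx
  obtain ⟨hq, hp⟩ := hx
  rw [Metric.mem_closedBall, dist_zero_right]
  have hε3 : 100 * ε₀ ^ 3 ≤ 100 * |ε₀| ^ 3 := by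
    have : ε₀ ^ 3 ≤ |ε₀| ^ 3 := (le_abs_self _).trans_eq (abs_pow ε₀ 3)
    linarith
  have hxi : ∀ j, ‖xi0 j‖ ≤ 3 := by
    intro j
    match j with
    | 0 => rw [norm_xi0_zero]; norm_num
    | 1 =>
      rw [norm_xi0_one]
      calc Real.sqrt 2 ≤ Real.sqrt (3 ^ 2) := Real.sqrt_le_sqrt (by norm_num)
        _ = 3 := Real.sqrt_sq (by norm_num)
    | 2 => rw [norm_xi0_two]; norm_num
  have hp' : ∀ j, ‖freq3 x.2 j‖ ≤ 3 + 100 * |ε₀| ^ 3 := by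
    intro j
    calc ‖freq3 x.2 j‖ ≤ ‖freq3 x.2 j - xi0 j‖ + ‖xi0 j‖ := norm_le_norm_sub_add _ _
      _ ≤ 100 * ε₀ ^ 3 + 3 := add_le_add (hp j) (hxi j)
      _ ≤ 3 + 100 * |ε₀| ^ 3 := by linarith
  have h0 : (0 : ℝ) ≤ 100 * |ε₀| ^ 3 := by positivity
  simp only [Prod.norm_def, max_le_iff]
  refine ⟨⟨?_, ?_, ?_⟩, ?_, ?_⟩
  · linarith [(hq 2).2, show ‖x.1.1‖ = ‖slotQ x.1 2‖ from rfl]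
  · linarith [(hq 0).2, show ‖x.1.2.1‖ = ‖slotQ x.1 0‖ from rfl]
  · linarith [(hq 1).2, show ‖x.1.2.2‖ = ‖slotQ x.1 1‖ from rfl]
  · linarith [hp' 0, show ‖x.2.1‖ = ‖freq3 x.2 0‖ from rfl]
  · linarith [hp' 1, show ‖x.2.2‖ = ‖freq3 x.2 1‖ from rfl]

/-- `cutSupport ⊆ GoodSet` when `200 ε₀³ < δ`. [folklore] -/
theorem cutSupport_subset_goodSet (hε : 0 < ε₀) (hδ : 200 * ε₀ ^ 3 < ndDelta) : cutSupport ε₀ ⊆ GoodSet := by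
  intro x hx
  obtain ⟨hq, hp⟩ := hx
  have ht := eps_cube_pos hε
  refine ⟨fun j h0 => ?_, fun j => lt_of_le_of_lt (hp j) (by linarith)⟩
  have := (hq j).1
  rw [h0, norm_zero] at this
  linarith

/-- Where the real cut-off is non-zero we are in `cutSupport` (`ε₀ ≤ 1/10`). [folklore] -/
theorem mem_cutSupport_of_realCut_ne_zero (hε : 0 < ε₀) (hε1 : ε₀ ≤ 1 / 10) {q : ℍ × ℍ × ℍ} {p : ℝ³ × ℝ³}
    (h : realCut hε q p ≠ 0) : (q, p) ∈ cutSupport ε₀ := by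
  unfold realCut at h
  simp only [mul_ne_zero_iff] at h
  obtain ⟨⟨⟨⟨hq, hR⟩, hB⟩, -⟩, -⟩ := h
  refine ⟨fun j => ⟨?_, ?_⟩, near_xi0_of_cutoffs hε hε1 hR hB⟩
  · by_contra hlt
    exact hq (qCut_eq_zero_of_norm_lt (j := j) (not_le.mp hlt))
  · by_contra hlt
    have key : ∀ t : ℝ, 2 < t → (gBump2 : ℝ → ℝ) (t ^ 2) = 0 := by
      intro t ht
      apply gBump2.zero_of_le_dist
      rw [Real.dist_eq, show gBump2.rOut = 3 / 4 from rfl, abs_of_pos (by nlinarith)]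
      nlinarith
    apply hq
    unfold qCut
    fin_cases j
    · change ¬‖q.2.1‖ ≤ 2 at hlt; rw [key _ (not_le.mp hlt)]; ring
    · change ¬‖q.2.2‖ ≤ 2 at hlt; rw [key _ (not_le.mp hlt)]; ring
    · change ¬‖q.1‖ ≤ 2 at hlt; rw [key _ (not_le.mp hlt)]; ring

variable {ψ}

/-- **The synthesis sum is bounded on the support of the cut-off.** [folklore] -/
theorem exists_bound_Ssum (hε : 0 < ε₀) (hδ : 200 * ε₀ ^ 3 < ndDelta) :
    ∃ S : ℝ, 0 ≤ S ∧ ∀ x ∈ cutSupport ε₀, ‖Ssum ψ x.1 x.2‖ ≤ S := by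
  have hcont : ContinuousOn (fun x : (ℍ × ℍ × ℍ) × (ℝ³ × ℝ³) => Ssum ψ x.1 x.2) (cutSupport ε₀) := fun x hx =>
    (contDiffAt_Ssum (cutSupport_subset_goodSet hε hδ hx)).continuousAt.continuousWithinAt
  obtain ⟨S, hS⟩ := (isCompact_cutSupport ε₀).exists_bound_of_continuousOn hcont
  exact ⟨max S 0, le_max_right _ _, fun x hx => (hS x hx).trans (le_max_left _ _)⟩

/-- **The profile coefficients are bounded** (Schwartz). [folklore] -/
theorem exists_bound_aVec : ∃ A : ℝ, 0 ≤ A ∧ ∀ j ζ, ‖aVec ψ j ζ‖ ≤ A := by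
  have hb : ∀ j, ∃ Aj : ℝ, ∀ ζ, ‖aVec ψ j ζ‖ ≤ Aj := by
    intro j
    refine ⟨SchwartzMap.seminorm ℂ 0 0 (𝓕 (ψ j)), fun ζ => ?_⟩
    unfold aVec
    rw [LinearIsometry.norm_map, ← SchwartzMap.fourier_coe]
    exact SchwartzMap.norm_le_seminorm ℂ _ _
  choose A hA using hb
  refine ⟨max (max (A 0) (A 1)) (max (A 2) 0), le_max_of_le_right (le_max_right _ _), fun j ζ => ?_⟩
  fin_cases j
  · exact (hA 0 ζ).trans (le_max_of_le_left (le_max_left _ _))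
  · exact (hA 1 ζ).trans (le_max_of_le_left (le_max_right _ _))
  · exact (hA 2 ζ).trans (le_max_of_le_right (le_max_left _ _))

end Bounds
/-! ### Integrability of the two integrands -/

section Integrability

variable {ε₀ : ℝ} {ψ : Fin 3 → 𝓢(ℝ³, ℂ³)} {X : Fin 3 → ℝ³ → ℂ³}

/-- `‖(R ⊗ 1) z‖ = ‖z‖`. [folklore] -/
theorem norm_rotMat (R : ℝ³ ≃ₗᵢ[ℝ] ℝ³) (z : ℂ³) : ‖rotMat R z‖ = ‖z‖ := by
  have h := enorm_rotMat R z
  rwa [← ofReal_norm, ← ofReal_norm, ENNReal.ofReal_eq_ofReal_iff (norm_nonneg _) (norm_nonneg _)] at h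

/-- `Λ` is jointly continuous in all five arguments. [folklore] -/
theorem continuous_Λ_all : Continuous fun v : (ℝ³ × ℝ³) × (ℂ³ × ℂ³ × ℂ³) => Λ v.1.1 v.1.2 v.2.1 v.2.2.1 v.2.2.2 := by
  have h : ContDiff ℝ ((⊤ : ℕ∞) : WithTop ℕ∞)
      fun v : (ℝ³ × ℝ³) × (ℂ³ × ℂ³ × ℂ³) => Λ v.1.1 v.1.2 v.2.1 v.2.2.1 v.2.2.2 :=
    contDiff_iff_contDiffAt.2 fun v => contDiffAt_Lambda contDiffAt_fst.fst contDiffAt_fst.snd contDiffAt_snd.fst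
      contDiffAt_snd.snd.fst contDiffAt_snd.snd.snd
  exact h.continuous

variable (ψ X)

/-- **The full integrand** `G(q, ξ) = ∏g₀(|qⱼ|) · w(ξ) F̃'(q, ξ) Λ_ξ(Y)` on `Q × (ℝ³)²`. [cite: Tao2016AveragedNS, §3.6 (3.16) p. 18] -/
def Gfun (hε : 0 < ε₀) (x : (ℍ × ℍ × ℍ) × (ℝ³ × ℝ³)) : ℂ :=
  ((qDensity x.1 : ℝ) : ℂ) * (((singleScaleWeight ε₀ x.2 : ℝ) : ℂ) * coreIntegrand ψ X hε x.1 x.2)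

/-- **The reduced integrand** `N(q, ξ) = ∏g₀(|qⱼ|) realCut(q, ξ) ∏ⱼ Xⱼ(ζⱼ)·P aⱼ(ζⱼ)` after the fibre identity. [cite: Tao2016AveragedNS, §3.6 (3.15) p. 18] -/
def Nfun (hε : 0 < ε₀) (x : (ℍ × ℍ × ℍ) × (ℝ³ × ℝ³)) : ℂ :=
  ((qDensity x.1 * realCut hε x.1 x.2 : ℝ) : ℂ) * hProd ψ X (rotFreq x)

variable {ψ X}

/-- The un-rotated frequencies as functions on `Q × (ℝ³)²` are measurable. [folklore] -/
theorem measurable_zetaVec (j : Fin 3) : Measurable fun x : (ℍ × ℍ × ℍ) × (ℝ³ × ℝ³) => zetaVec x.1 x.2 j := by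
  unfold zetaVec
  have h := measurable_qrotFun_uncurry.comp
    ((continuous_star.measurable.comp ((contDiff_slotQ j).continuous.measurable.comp measurable_fst)).prodMk
      ((contDiff_freq3_apply j).continuous.measurable.comp (measurable_snd (α := ℍ × ℍ × ℍ) (β := ℝ³ × ℝ³))))
  exact h

/-- `G` is measurable (for measurable `Xⱼ`). [folklore] -/
theorem measurable_Gfun (hε : 0 < ε₀) (hε1 : ε₀ ≤ 1 / 10) (hδ : 200 * ε₀ ^ 3 < ndDelta) (hX : ∀ j, Measurable (X j)) :
    Measurable (Gfun ψ X hε) := by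
  unfold Gfun coreIntegrand
  have hq : Measurable fun x : (ℍ × ℍ × ℍ) × (ℝ³ × ℝ³) => ((qDensity x.1 : ℝ) : ℂ) :=
    Complex.measurable_ofReal.comp (continuous_qDensity.measurable.comp measurable_fst)
  have hw : Measurable fun x : (ℍ × ℍ × ℍ) × (ℝ³ × ℝ³) => ((singleScaleWeight ε₀ x.2 : ℝ) : ℂ) :=
    Complex.measurable_ofReal.comp ((measurable_singleScaleWeight ε₀).comp measurable_snd)
  have hF : Measurable fun x : (ℍ × ℍ × ℍ) × (ℝ³ × ℝ³) => Fflat ψ hε x.1 x.2 :=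
    (contDiff_Fflat (ψ := ψ) hε hε1 hδ).continuous.measurable
  have hΛ : Measurable fun x : (ℍ × ℍ × ℍ) × (ℝ³ × ℝ³) =>
      Λ (freq3 x.2 0) (freq3 x.2 1) (Yrot X x.1 x.2 0) (Yrot X x.1 x.2 1) (Yrot X x.1 x.2 2) := by
    have h := continuous_Λ_all.measurable.comp
      ((((contDiff_freq3_apply 0).continuous.measurable.comp measurable_snd).prodMk
        ((contDiff_freq3_apply 1).continuous.measurable.comp measurable_snd)).prodMk
        ((measurable_Yrot hX 0).prodMk ((measurable_Yrot hX 1).prodMk (measurable_Yrot hX 2))))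
    exact h
  exact hq.mul (hw.mul (hF.mul hΛ))

/-- `P_ζ v` is jointly measurable. [folklore] -/
theorem measurable_projPerp : Measurable fun y : ℝ³ × ℂ³ => projPerp y.1 y.2 := by
  unfold projPerp
  have hu : Measurable fun y : ℝ³ × ℂ³ => complexify (udir y.1) :=
    (FunctionSpaces.EuclideanSpace.continuous_complexify (ι := Fin 3)).measurable.comp (measurable_udir.comp measurable_fst)
  have hc : Measurable fun y : ℝ³ × ℂ³ => cdot y.2 (complexify (udir y.1)) :=
    contDiff_cdot.continuous.measurable.comp (measurable_snd.prodMk hu)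
  exact measurable_snd.sub (hc.smul hu)

/-- `hProd` is measurable (for measurable `Xⱼ`). [folklore] -/
theorem measurable_hProd (hX : ∀ j, Measurable (X j)) : Measurable (hProd ψ X) := by
  unfold hProd
  have hslot : ∀ j, Measurable fun v : ℝ³ => cdot (X j v) (projPerp v (aVec ψ j v)) := fun j =>
    contDiff_cdot.continuous.measurable.comp ((hX j).prodMk
      (measurable_projPerp.comp (measurable_id.prodMk (contDiff_aVec ψ j).continuous.measurable)))
  exact (((hslot 0).comp measurable_fst).mul ((hslot 1).comp (measurable_fst.comp measurable_snd))).mul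
    ((hslot 2).comp (measurable_snd.comp measurable_snd))

/-- The real cut-off is measurable. [folklore] -/
theorem measurable_realCut (hε : 0 < ε₀) : Measurable fun x : (ℍ × ℍ × ℍ) × (ℝ³ × ℝ³) => realCut hε x.1 x.2 := by
  unfold realCut
  have hqCut : Measurable fun x : (ℍ × ℍ × ℍ) × (ℝ³ × ℝ³) => qCut x.1 := by
    unfold qCut
    have hn : ∀ {f : (ℍ × ℍ × ℍ) × (ℝ³ × ℝ³) → ℍ}, Measurable f →
        Measurable fun x => (gBump2 : ℝ → ℝ) (‖f x‖ ^ 2) := fun hf =>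
      gBump2.continuous.measurable.comp (hf.norm.pow_const 2)
    exact ((hn (measurable_fst.comp measurable_fst)).mul (hn ((measurable_fst.comp measurable_snd).comp measurable_fst))).mul
      (hn ((measurable_snd.comp measurable_snd).comp measurable_fst))
  have hf : ∀ j, Measurable fun x : (ℍ × ℍ × ℍ) × (ℝ³ × ℝ³) => freq3 x.2 j := fun j =>
    (contDiff_freq3_apply j).continuous.measurable.comp measurable_snd
  have hpRad : Measurable fun x : (ℍ × ℍ × ℍ) × (ℝ³ × ℝ³) => pRad hε x.2 := by
    unfold pRad
    exact (((hf 0).norm.mul (hf 1).norm).mul (hf 2).norm).mul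
      ((((kappaBump hε 0).continuous.measurable.comp (hf 0).norm).mul
        ((kappaBump hε 1).continuous.measurable.comp (hf 1).norm)).mul
        ((kappaBump hε 2).continuous.measurable.comp (hf 2).norm))
  have hpFrame : Measurable fun x : (ℍ × ℍ × ℍ) × (ℝ³ × ℝ³) => pFrame hε x.2 := by
    unfold pFrame nVec gammaNormal
    exact ((dirBump hε).continuous.measurable.comp (measurable_udir.comp (hf 2))).mul
      ((normalBump hε).continuous.measurable.comp (measurable_udir.comp
        ((contDiff_cross (n := 0)).continuous.measurable.comp ((hf 0).prodMk (hf 1)))))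
  have hzCut : Measurable fun x : (ℍ × ℍ × ℍ) × (ℝ³ × ℝ³) => zCut hε x.1 x.2 := by
    unfold zCut
    exact (((zetaBump hε 0).continuous.measurable.comp (measurable_zetaVec 0)).mul
      ((zetaBump hε 1).continuous.measurable.comp (measurable_zetaVec 1))).mul
      ((zetaBump hε 2).continuous.measurable.comp (measurable_zetaVec 2))
  exact (((hqCut.mul hpRad).mul hpFrame).mul hzCut).mul measurable_const

/-- `N` is measurable. [folklore] -/
theorem measurable_Nfun (hε : 0 < ε₀) (hX : ∀ j, Measurable (X j)) : Measurable (Nfun ψ X hε) := by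
  unfold Nfun
  exact (Complex.measurable_ofReal.comp ((continuous_qDensity.measurable.comp measurable_fst).mul
    (measurable_realCut hε))).mul ((measurable_hProd hX).comp measurable_rotFreq)

end Integrability
/-! ### Bounds and integrability -/

section Assembly

variable {ε₀ : ℝ} {ψ : Fin 3 → 𝓢(ℝ³, ℂ³)} {X : Fin 3 → ℝ³ → ℂ³}

/-- `realCut ≥ 0`. [folklore] -/
theorem realCut_nonneg (hε : 0 < ε₀) (q : ℍ × ℍ × ℍ) (p : ℝ³ × ℝ³) : 0 ≤ realCut hε q p := by
  unfold realCut qCut pRad pFrame zCut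
  have := (rotDensityConst_pos hε).le
  exact mul_nonneg (mul_nonneg (mul_nonneg (mul_nonneg
    (mul_nonneg (mul_nonneg gBump2.nonneg gBump2.nonneg) gBump2.nonneg)
    (mul_nonneg (by positivity) (mul_nonneg (mul_nonneg (kappaBump hε 0).nonneg (kappaBump hε 1).nonneg)
      (kappaBump hε 2).nonneg)))
    (mul_nonneg (dirBump hε).nonneg (normalBump hε).nonneg))
    (mul_nonneg (mul_nonneg (zetaBump hε 0).nonneg (zetaBump hε 1).nonneg) (zetaBump hε 2).nonneg))
    (inv_nonneg.mpr this)

/-- `realCut ≤ qCut · pRad · pFrame / C` (as `zCut ≤ 1`). [folklore] -/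
theorem realCut_le (hε : 0 < ε₀) (q : ℍ × ℍ × ℍ) (p : ℝ³ × ℝ³) :
    realCut hε q p ≤ qCut q * pRad hε p * pFrame hε p * (rotDensityConst hε)⁻¹ := by
  unfold realCut
  have hC := (rotDensityConst_pos hε).le
  have hz1 : zCut hε q p ≤ 1 := by rw [zCut_eq_zCut3]; exact (zCut3_nonneg_le_one hε _).2
  have hz0 : 0 ≤ zCut hε q p := by rw [zCut_eq_zCut3]; exact (zCut3_nonneg_le_one hε _).1
  have hA : 0 ≤ qCut q * pRad hε p * pFrame hε p := by
    unfold qCut pRad pFrame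
    exact mul_nonneg (mul_nonneg (mul_nonneg (mul_nonneg gBump2.nonneg gBump2.nonneg) gBump2.nonneg)
      (mul_nonneg (by positivity) (mul_nonneg (mul_nonneg (kappaBump hε 0).nonneg (kappaBump hε 1).nonneg)
        (kappaBump hε 2).nonneg))) (mul_nonneg (dirBump hε).nonneg (normalBump hε).nonneg)
  calc _ ≤ qCut q * pRad hε p * pFrame hε p * 1 * (rotDensityConst hε)⁻¹ := by gcongr
    _ = _ := by rw [mul_one]

/-- On `cutSupport`, `|ξ₂| + |ξ₁| ≤ 5` (`ε₀ ≤ 1/10`). [folklore] -/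
theorem norm_freq_sum_le {x : (ℍ × ℍ × ℍ) × (ℝ³ × ℝ³)} (hε : 0 < ε₀) (hε1 : ε₀ ≤ 1 / 10) (hx : x ∈ cutSupport ε₀) :
    ‖freq3 x.2 1‖ + ‖freq3 x.2 0‖ ≤ 5 := by
  obtain ⟨-, hp⟩ := hx
  have ht : ε₀ ^ 3 ≤ 1 / 1000 := by
    calc ε₀ ^ 3 ≤ (1 / 10) ^ 3 := by gcongr
      _ = 1 / 1000 := by norm_num
  have hs : Real.sqrt 2 ≤ 2 := by
    calc Real.sqrt 2 ≤ Real.sqrt (2 ^ 2) := Real.sqrt_le_sqrt (by norm_num)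
      _ = 2 := Real.sqrt_sq (by norm_num)
  have h0 : ‖freq3 x.2 0‖ ≤ 100 * ε₀ ^ 3 + 1 := by
    calc ‖freq3 x.2 0‖ ≤ ‖freq3 x.2 0 - xi0 0‖ + ‖xi0 0‖ := norm_le_norm_sub_add _ _
      _ ≤ 100 * ε₀ ^ 3 + 1 := by rw [norm_xi0_zero]; exact add_le_add (hp 0) le_rfl
  have h1 : ‖freq3 x.2 1‖ ≤ 100 * ε₀ ^ 3 + 2 := by
    calc ‖freq3 x.2 1‖ ≤ ‖freq3 x.2 1 - xi0 1‖ + ‖xi0 1‖ := norm_le_norm_sub_add _ _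
      _ ≤ 100 * ε₀ ^ 3 + 2 := by rw [norm_xi0_one]; exact add_le_add (hp 1) hs
  linarith

/-- `|Yⱼ(q, ξ)| = |Xⱼ(ζⱼ)|` (`qⱼ ≠ 0`). [folklore] -/
theorem norm_Yrot {q : ℍ × ℍ × ℍ} (hq : ∀ j, slotQ q j ≠ 0) (p : ℝ³ × ℝ³) (j : Fin 3) :
    ‖Yrot X q p j‖ = ‖X j (zetaVec q p j)‖ := by
  unfold Yrot zetaVec
  rw [norm_rotMat, qrot_symm_apply, qrot_apply (star_ne_zero.mpr (hq j))]

/-- **Pointwise bound for `G`**: `|G| ≤ 5 S C⁻¹ · rotWeight · ∏ⱼ |Xⱼ(ζⱼ)|`. [folklore] -/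
theorem norm_Gfun_le (hε : 0 < ε₀) (hε1 : ε₀ ≤ 1 / 10) {S : ℝ} (hS0 : 0 ≤ S)
    (hS : ∀ x ∈ cutSupport ε₀, ‖Ssum ψ x.1 x.2‖ ≤ S) (x : (ℍ × ℍ × ℍ) × (ℝ³ × ℝ³)) :
    ‖Gfun ψ X hε x‖ ≤ (5 * S * (rotDensityConst hε)⁻¹) *
      ((rotWeight gTotal (Rweight hε) (Bweight hε) x).toReal *
        (‖X 0 (zetaVec x.1 x.2 0)‖ * ‖X 1 (zetaVec x.1 x.2 1)‖ * ‖X 2 (zetaVec x.1 x.2 2)‖)) := by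
  have hC := (rotDensityConst_pos hε).le
  by_cases hrc : realCut hε x.1 x.2 = 0
  · have : Gfun ψ X hε x = 0 := by
      unfold Gfun coreIntegrand Fflat; rw [hrc]; simp only [Complex.ofReal_zero, zero_mul, mul_zero]
    rw [this, norm_zero]
    exact mul_nonneg (mul_nonneg (by linarith) (inv_nonneg.mpr hC)) (mul_nonneg ENNReal.toReal_nonneg (by positivity))
  · have hmem := mem_cutSupport_of_realCut_ne_zero hε hε1 hrc
    have hq : ∀ j, slotQ x.1 j ≠ 0 := fun j h0 => by
      have := (hmem.1 j).1; rw [h0, norm_zero] at this; linarith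
    have h5 := norm_freq_sum_le hε hε1 hmem
    have hrc0 := realCut_nonneg hε x.1 x.2
    have hqd := qDensity_nonneg x.1
    -- the norm of the integrand
    have e : ‖Gfun ψ X hε x‖ = qDensity x.1 * (|singleScaleWeight ε₀ x.2| * (realCut hε x.1 x.2 * ‖Ssum ψ x.1 x.2‖ *
        ‖Λ (freq3 x.2 0) (freq3 x.2 1) (Yrot X x.1 x.2 0) (Yrot X x.1 x.2 1) (Yrot X x.1 x.2 2)‖)) := by
      unfold Gfun coreIntegrand Fflat
      rw [norm_mul, norm_mul, norm_mul, norm_mul, Complex.norm_real, Complex.norm_real, Complex.norm_real,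
        Real.norm_eq_abs, Real.norm_eq_abs, Real.norm_eq_abs, abs_of_nonneg hqd, abs_of_nonneg hrc0]
    rw [e]
    have hΛ := norm_Λ_le' (freq3 x.2 0) (freq3 x.2 1) (Yrot X x.1 x.2 0) (Yrot X x.1 x.2 1) (Yrot X x.1 x.2 2)
    rw [norm_Yrot hq, norm_Yrot hq, norm_Yrot hq] at hΛ
    set P := ‖X 0 (zetaVec x.1 x.2 0)‖ * ‖X 1 (zetaVec x.1 x.2 1)‖ * ‖X 2 (zetaVec x.1 x.2 2)‖ with hP
    have hP0 : 0 ≤ P := by positivity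
    have hw := abs_singleScaleWeight_le_one ε₀ x.2
    have hrl := realCut_le hε x.1 x.2
    have hSS : ‖Ssum ψ x.1 x.2‖ ≤ S := hS x hmem
    have hΛ5 : ‖Λ (freq3 x.2 0) (freq3 x.2 1) (Yrot X x.1 x.2 0) (Yrot X x.1 x.2 1) (Yrot X x.1 x.2 2)‖ ≤ 5 * P :=
      hΛ.trans (mul_le_mul_of_nonneg_right h5 hP0)
    have hB0 : 0 ≤ qCut x.1 * pRad hε x.2 * pFrame hε x.2 * (rotDensityConst hε)⁻¹ := hrc0.trans hrl
    have h1 : realCut hε x.1 x.2 * ‖Ssum ψ x.1 x.2‖ ≤ qCut x.1 * pRad hε x.2 * pFrame hε x.2 * (rotDensityConst hε)⁻¹ * S :=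
      mul_le_mul hrl hSS (norm_nonneg _) hB0
    have h2 : realCut hε x.1 x.2 * ‖Ssum ψ x.1 x.2‖ *
        ‖Λ (freq3 x.2 0) (freq3 x.2 1) (Yrot X x.1 x.2 0) (Yrot X x.1 x.2 1) (Yrot X x.1 x.2 2)‖ ≤
        qCut x.1 * pRad hε x.2 * pFrame hε x.2 * (rotDensityConst hε)⁻¹ * S * (5 * P) :=
      mul_le_mul h1 hΛ5 (norm_nonneg _) (mul_nonneg hB0 hS0)
    have h3 : |singleScaleWeight ε₀ x.2| * (realCut hε x.1 x.2 * ‖Ssum ψ x.1 x.2‖ *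
        ‖Λ (freq3 x.2 0) (freq3 x.2 1) (Yrot X x.1 x.2 0) (Yrot X x.1 x.2 1) (Yrot X x.1 x.2 2)‖) ≤
        1 * (qCut x.1 * pRad hε x.2 * pFrame hε x.2 * (rotDensityConst hε)⁻¹ * S * (5 * P)) :=
      mul_le_mul hw h2 (mul_nonneg (mul_nonneg hrc0 (norm_nonneg _)) (norm_nonneg _)) zero_le_one
    calc _ ≤ qDensity x.1 * (1 * (qCut x.1 * pRad hε x.2 * pFrame hε x.2 * (rotDensityConst hε)⁻¹ * S * (5 * P))) :=
          mul_le_mul_of_nonneg_left h3 hqd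
      _ = (5 * S * (rotDensityConst hε)⁻¹) * ((qDensity x.1 * qCut x.1 * pRad hε x.2 * pFrame hε x.2) * P) := by ring
      _ = _ := by rw [rotWeight_toReal hε x]

/-- **Pointwise bound for `N`**: `|N| ≤ 8A³ C⁻¹ · rotWeight · ∏ⱼ |Xⱼ(ζⱼ)|`. [folklore] -/
theorem norm_Nfun_le (hε : 0 < ε₀) {A : ℝ} (hA0 : 0 ≤ A) (hA : ∀ j ζ, ‖aVec ψ j ζ‖ ≤ A)
    (x : (ℍ × ℍ × ℍ) × (ℝ³ × ℝ³)) :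
    ‖Nfun ψ X hε x‖ ≤ (8 * A ^ 3 * (rotDensityConst hε)⁻¹) *
      ((rotWeight gTotal (Rweight hε) (Bweight hε) x).toReal *
        (‖X 0 (zetaVec x.1 x.2 0)‖ * ‖X 1 (zetaVec x.1 x.2 1)‖ * ‖X 2 (zetaVec x.1 x.2 2)‖)) := by
  have hC := (rotDensityConst_pos hε).le
  have hrc0 := realCut_nonneg hε x.1 x.2
  have hqd := qDensity_nonneg x.1
  have hslot : ∀ j v, ‖cdot (X j v) (projPerp v (aVec ψ j v))‖ ≤ ‖X j v‖ * (2 * A) := fun j v =>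
    (norm_cdot_le _ _).trans (mul_le_mul_of_nonneg_left ((norm_projPerp_le _ _).trans (by linarith [hA j v]))
      (norm_nonneg _))
  have hh : ‖hProd ψ X (rotFreq x)‖ ≤ ‖X 0 (zetaVec x.1 x.2 0)‖ * (2 * A) * (‖X 1 (zetaVec x.1 x.2 1)‖ * (2 * A)) *
      (‖X 2 (zetaVec x.1 x.2 2)‖ * (2 * A)) := by
    unfold hProd
    rw [rotFreq_eq, norm_mul, norm_mul]
    have := hslot 0 (zetaVec x.1 x.2 0)
    have := hslot 1 (zetaVec x.1 x.2 1)
    have := hslot 2 (zetaVec x.1 x.2 2)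
    gcongr
  unfold Nfun
  rw [norm_mul, Complex.norm_real, Real.norm_eq_abs, abs_of_nonneg (mul_nonneg hqd hrc0)]
  have hrl := realCut_le hε x.1 x.2
  have hB0 : 0 ≤ qDensity x.1 * (qCut x.1 * pRad hε x.2 * pFrame hε x.2 * (rotDensityConst hε)⁻¹) :=
    mul_nonneg hqd (hrc0.trans hrl)
  calc _ ≤ qDensity x.1 * (qCut x.1 * pRad hε x.2 * pFrame hε x.2 * (rotDensityConst hε)⁻¹) *
        (‖X 0 (zetaVec x.1 x.2 0)‖ * (2 * A) * (‖X 1 (zetaVec x.1 x.2 1)‖ * (2 * A)) * (‖X 2 (zetaVec x.1 x.2 2)‖ * (2 * A))) :=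
        mul_le_mul (mul_le_mul_of_nonneg_left hrl hqd) hh (norm_nonneg _) hB0
    _ = (8 * A ^ 3 * (rotDensityConst hε)⁻¹) * ((qDensity x.1 * qCut x.1 * pRad hε x.2 * pFrame hε x.2) *
        (‖X 0 (zetaVec x.1 x.2 0)‖ * ‖X 1 (zetaVec x.1 x.2 1)‖ * ‖X 2 (zetaVec x.1 x.2 2)‖)) := by ring
    _ = _ := by rw [rotWeight_toReal hε x]

/-- **The dominating function is integrable**: `∫ rotWeight ∏|Xⱼ(ζⱼ)| < ∞` by the disintegration
and `∏ⱼ ‖Xⱼ‖_{L¹} < ∞`. [cite: Tao2016AveragedNS, §3.6 p. 18] -/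
theorem integrable_dominator (hε : 0 < ε₀) (hXm : ∀ j, Measurable (X j)) (hXi : ∀ j, Integrable (X j)) (K : ℝ) :
    Integrable fun x : (ℍ × ℍ × ℍ) × (ℝ³ × ℝ³) => K * ((rotWeight gTotal (Rweight hε) (Bweight hε) x).toReal *
      (‖X 0 (zetaVec x.1 x.2 0)‖ * ‖X 1 (zetaVec x.1 x.2 1)‖ * ‖X 2 (zetaVec x.1 x.2 2)‖)) := by
  refine Integrable.const_mul ?_ K
  have hmeas : Measurable fun x : (ℍ × ℍ × ℍ) × (ℝ³ × ℝ³) => (rotWeight gTotal (Rweight hε) (Bweight hε) x).toReal *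
      (‖X 0 (zetaVec x.1 x.2 0)‖ * ‖X 1 (zetaVec x.1 x.2 1)‖ * ‖X 2 (zetaVec x.1 x.2 2)‖) :=
    (measurable_rotWeight' hε).ennreal_toReal.mul ((((hXm 0).comp (measurable_zetaVec 0)).norm.mul
      ((hXm 1).comp (measurable_zetaVec 1)).norm).mul ((hXm 2).comp (measurable_zetaVec 2)).norm)
  refine ⟨hmeas.aestronglyMeasurable, ?_⟩
  unfold HasFiniteIntegral
  have hpt : ∀ x : (ℍ × ℍ × ℍ) × (ℝ³ × ℝ³), ‖(rotWeight gTotal (Rweight hε) (Bweight hε) x).toReal *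
      (‖X 0 (zetaVec x.1 x.2 0)‖ * ‖X 1 (zetaVec x.1 x.2 1)‖ * ‖X 2 (zetaVec x.1 x.2 2)‖)‖ₑ =
      rotWeight gTotal (Rweight hε) (Bweight hε) x *
        (‖X 0 (zetaVec x.1 x.2 0)‖ₑ * ‖X 1 (zetaVec x.1 x.2 1)‖ₑ * ‖X 2 (zetaVec x.1 x.2 2)‖ₑ) := by
    intro x
    rw [Real.enorm_eq_ofReal (mul_nonneg ENNReal.toReal_nonneg (by positivity)), ENNReal.ofReal_mul ENNReal.toReal_nonneg,
      ENNReal.ofReal_toReal (rotWeight_lt_top hε x).ne, ENNReal.ofReal_mul (by positivity),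
      ENNReal.ofReal_mul (norm_nonneg _), ofReal_norm, ofReal_norm, ofReal_norm]
  simp_rw [hpt]
  have hle := lintegral_rotWeight_prod_le hε (h := fun j v => ‖X j v‖ₑ) fun j => (hXm j).enorm
  refine lt_of_le_of_lt hle ?_
  refine ENNReal.mul_lt_top (rotDensityConstE_pos_lt_top hε).2 ?_
  exact ENNReal.mul_lt_top (hXi 0).2 (ENNReal.mul_lt_top (hXi 1).2 (hXi 2).2)

/-- **`G` is integrable on `Q × (ℝ³)²`.** [cite: Tao2016AveragedNS, §3.6 p. 18] -/
theorem integrable_Gfun (hε : 0 < ε₀) (hε1 : ε₀ ≤ 1 / 10) (hδ : 200 * ε₀ ^ 3 < ndDelta)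
    (hXm : ∀ j, Measurable (X j)) (hXi : ∀ j, Integrable (X j)) : Integrable (Gfun ψ X hε) := by
  obtain ⟨S, hS0, hS⟩ := exists_bound_Ssum (ψ := ψ) hε hδ
  exact (integrable_dominator hε hXm hXi (5 * S * (rotDensityConst hε)⁻¹)).mono'
    (measurable_Gfun hε hε1 hδ hXm).aestronglyMeasurable (ae_of_all _ (norm_Gfun_le hε hε1 hS0 hS))

/-- **`N` is integrable on `Q × (ℝ³)²`.** [cite: Tao2016AveragedNS, §3.6 p. 18] -/
theorem integrable_Nfun (hε : 0 < ε₀) (hXm : ∀ j, Measurable (X j)) (hXi : ∀ j, Integrable (X j)) :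
    Integrable (Nfun ψ X hε) := by
  obtain ⟨A, hA0, hA⟩ := exists_bound_aVec (ψ := ψ)
  exact (integrable_dominator hε hXm hXi (8 * A ^ 3 * (rotDensityConst hε)⁻¹)).mono'
    (measurable_Nfun hε hXm).aestronglyMeasurable (ae_of_all _ (norm_Nfun_le hε hA0 hA))

/-! ### The fibre step -/

/-- The quaternion density is invariant under the angle actions. [folklore] -/
theorem qDensity_torus {u₁ u₂ u₃ : ℍ} (h₁ : ‖u₁‖ = 1) (h₂ : ‖u₂‖ = 1) (h₃ : ‖u₃‖ = 1) (q : ℍ × ℍ × ℍ) :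
    qDensity (slotB h₁ (slotC h₂ (slotA h₃ q))) = qDensity q := by
  show (gBump : ℝ → ℝ) ‖u₃ * q.1‖ * gBump ‖u₁ * q.2.1‖ * gBump ‖u₂ * q.2.2‖ = _
  rw [norm_mul, norm_mul, norm_mul, h₁, h₂, h₃, one_mul, one_mul, one_mul]
  rfl

/-- **The fibre step**: for `ξ` with integrable fibre, `∫ G(q, ξ) dq = ∫ N(q, ξ) dq` (torus average,
fibre identity, `w ≡ 1`). [cite: Tao2016AveragedNS, §3.6–3.9 pp. 18–20] -/
theorem fibre_step (hε : 0 < ε₀) (hε1 : ε₀ ≤ 1 / 100) (hδ : 200 * ε₀ ^ 3 < ndDelta) (p : ℝ³ × ℝ³)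
    (hint : Integrable fun q : ℍ × ℍ × ℍ => Gfun ψ X hε (q, p)) :
    ∫ q, Gfun ψ X hε (q, p) = ∫ q, Nfun ψ X hε (q, p) := by
  have hε1' : ε₀ ≤ 1 / 10 := hε1.trans (by norm_num)
  by_cases hgood : pRad hε p ≠ 0 ∧ pFrame hε p ≠ 0
  · have hg := goodFreq_of_cutoffs hε hε1' hδ hgood.1 hgood.2
    have hw : singleScaleWeight ε₀ p = 1 := singleScaleWeight_eq_one_of_cutoffs hε hε1 hgood.1 hgood.2
    rw [integral_eq_integral_torusAverage (norm_udir (hg.ne 0)) (norm_udir (hg.ne 1)) (norm_udir (hg.ne 2)) hint]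
    -- the torus integral of `G` at `q`
    have htor : ∀ q : ℍ × ℍ × ℍ, (∫ θ₃ in (0 : ℝ)..2 * π, ∫ θ₂ in (0 : ℝ)..2 * π, ∫ θ₁ in (0 : ℝ)..2 * π,
        Gfun ψ X hε (slotB (norm_quatExp (norm_udir (hg.ne 0)) θ₁)
          (slotC (norm_quatExp (norm_udir (hg.ne 1)) θ₂) (slotA (norm_quatExp (norm_udir (hg.ne 2)) θ₃) q)), p)) =
        ((qDensity q : ℝ) : ℂ) * ((2 * (π : ℂ)) ^ 3 * (((realCut hε q p : ℝ) : ℂ) * hProd ψ X (rotFreq (q, p)))) := by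
      intro q
      have hpt : ∀ θ₁ θ₂ θ₃ : ℝ, Gfun ψ X hε (slotB (norm_quatExp (norm_udir (hg.ne 0)) θ₁)
          (slotC (norm_quatExp (norm_udir (hg.ne 1)) θ₂) (slotA (norm_quatExp (norm_udir (hg.ne 2)) θ₃) q)), p) =
          ((qDensity q : ℝ) : ℂ) * coreIntegrand ψ X hε (slotB (norm_quatExp (norm_udir (hg.ne 0)) θ₁)
            (slotC (norm_quatExp (norm_udir (hg.ne 1)) θ₂) (slotA (norm_quatExp (norm_udir (hg.ne 2)) θ₃) q))) p := by
        intro θ₁ θ₂ θ₃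
        unfold Gfun
        rw [qDensity_torus, hw, Complex.ofReal_one, one_mul]
      have s1 := intervalIntegral.integral_congr (μ := volume) (a := (0 : ℝ)) (b := 2 * π) fun θ₃ _ =>
        intervalIntegral.integral_congr (μ := volume) (a := (0 : ℝ)) (b := 2 * π) fun θ₂ _ =>
          intervalIntegral.integral_congr (μ := volume) (a := (0 : ℝ)) (b := 2 * π) fun θ₁ _ => hpt θ₁ θ₂ θ₃
      rw [s1]
      simp only [intervalIntegral.integral_const_mul]
      rw [torus_integral_core hε hg q]
    simp_rw [htor]
    have e2 : ∀ q : ℍ × ℍ × ℍ, ((qDensity q : ℝ) : ℂ) * ((2 * (π : ℂ)) ^ 3 * (((realCut hε q p : ℝ) : ℂ) *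
        hProd ψ X (rotFreq (q, p)))) = (2 * (π : ℂ)) ^ 3 * Nfun ψ X hε (q, p) := by
      intro q; unfold Nfun; push_cast; ring
    simp_rw [e2]
    rw [MeasureTheory.integral_const_mul, Complex.real_smul]
    push_cast
    have hπ : (2 * (π : ℂ)) ≠ 0 := by
      have : (π : ℂ) ≠ 0 := Complex.ofReal_ne_zero.mpr Real.pi_ne_zero
      exact mul_ne_zero two_ne_zero this
    field_simp
  · -- the fibre is identically zero
    have hrc : ∀ q, realCut hε q p = 0 := by
      intro q
      unfold realCut
      rcases not_and_or.mp hgood with h | h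
      · rw [not_ne_iff.mp h]; ring
      · rw [not_ne_iff.mp h]; ring
    have hG : ∀ q, Gfun ψ X hε (q, p) = 0 := by
      intro q; unfold Gfun coreIntegrand Fflat; rw [hrc q]; simp only [Complex.ofReal_zero, zero_mul, mul_zero]
    have hN : ∀ q, Nfun ψ X hε (q, p) = 0 := by
      intro q; unfold Nfun; rw [hrc q]; simp only [mul_zero, Complex.ofReal_zero, zero_mul]
    simp_rw [hG, hN]

/-! ### Assembly -/

/-- The normalised separated weight `f(ζ) = C⁻¹ χ(ζ) ∏ⱼ Xⱼ(ζⱼ)·P aⱼ(ζⱼ)` on `(ℝ³)³`. [folklore] -/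
def fFun (ψ : Fin 3 → 𝓢(ℝ³, ℂ³)) (X : Fin 3 → ℝ³ → ℂ³) (hε : 0 < ε₀) (ζ : ℝ³ × ℝ³ × ℝ³) : ℂ :=
  ((((rotDensityConst hε)⁻¹ * zCut3 hε ζ : ℝ)) : ℂ) * hProd ψ X ζ

/-- `N(x) = rotWeight(x) • f(ζ(x))`. [folklore] -/
theorem Nfun_eq_smul (hε : 0 < ε₀) (x : (ℍ × ℍ × ℍ) × (ℝ³ × ℝ³)) :
    Nfun ψ X hε x = (rotWeight gTotal (Rweight hε) (Bweight hε) x).toReal • fFun ψ X hε (rotFreq x) := by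
  unfold Nfun fFun
  rw [rotWeight_toReal hε x, Complex.real_smul, ← mul_assoc, ← zCut_eq_zCut3]
  congr 1
  unfold realCut
  push_cast
  ring

/-- **The disintegration step**: `∫ N = ∫ χ(ζ) ∏ⱼ Xⱼ(ζⱼ)·P aⱼ(ζⱼ) dζ`. [cite: Tao2016AveragedNS, §3.6 p. 18] -/
theorem integral_Nfun (hε : 0 < ε₀) (hε1 : ε₀ ≤ 1 / 10) (hXm : ∀ j, Measurable (X j)) :
    ∫ x, Nfun ψ X hε x = ∫ ζ : ℝ³ × ℝ³ × ℝ³, ((zCut3 hε ζ : ℝ) : ℂ) * hProd ψ X ζ := by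
  have hfm : Measurable (fFun ψ X hε) := by
    unfold fFun
    exact (Complex.measurable_ofReal.comp (measurable_const.mul (continuous_zCut3 hε).measurable)).mul
      (measurable_hProd hXm)
  simp_rw [Nfun_eq_smul hε]
  rw [← integral_withDensity_eq_integral_toReal_smul₀ (measurable_rotWeight' hε).aemeasurable
    (ae_of_all _ (rotWeight_lt_top hε)),
    ← integral_rotFreq_withDensity gTotal measurable_gTotal (Rweight hε) (measurable_Rweight hε) (Bweight hε)
      (measurable_Bweight hε) hfm.aestronglyMeasurable]
  rw [integral_withDensity_eq_integral_toReal_smul₀]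
  · refine integral_congr_ae (ae_of_all _ fun ζ => ?_)
    show (rotDensityConstE hε * triWeight (Rweight hε) ζ).toReal • fFun ψ X hε ζ = _
    unfold fFun
    rw [Complex.real_smul, ← mul_assoc, ← Complex.ofReal_mul, density_mul_zCut3 hε hε1]
  · exact (measurable_const.mul (measurable_triWeight (measurable_Rweight hε))).aemeasurable
  · refine ae_of_all _ fun ζ => ?_
    show rotDensityConstE hε * triWeight (Rweight hε) ζ < ⊤
    exact ENNReal.mul_lt_top (rotDensityConstE_pos_lt_top hε).2
      (lt_of_le_of_lt (triWeight_Rweight_le_one hε ζ) ENNReal.one_lt_top)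

/-- **The separated integral factorises.** [folklore] -/
theorem integral_zCut3_hProd (hε : 0 < ε₀) :
    ∫ ζ : ℝ³ × ℝ³ × ℝ³, ((zCut3 hε ζ : ℝ) : ℂ) * hProd ψ X ζ =
      (∫ v, (((zetaBump hε 0) v : ℝ) : ℂ) * cdot (X 0 v) (projPerp v (aVec ψ 0 v))) *
        ((∫ v, (((zetaBump hε 1) v : ℝ) : ℂ) * cdot (X 1 v) (projPerp v (aVec ψ 1 v))) *
          ∫ v, (((zetaBump hε 2) v : ℝ) : ℂ) * cdot (X 2 v) (projPerp v (aVec ψ 2 v))) := by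
  set F : Fin 3 → ℝ³ → ℂ := fun j v => (((zetaBump hε j) v : ℝ) : ℂ) * cdot (X j v) (projPerp v (aVec ψ j v)) with hF
  have e : ∀ ζ : ℝ³ × ℝ³ × ℝ³, ((zCut3 hε ζ : ℝ) : ℂ) * hProd ψ X ζ = F 0 ζ.1 * (F 1 ζ.2.1 * F 2 ζ.2.2) := by
    intro ζ; simp only [hF, zCut3, hProd]; push_cast; ring
  simp_rw [e]
  calc ∫ ζ : ℝ³ × ℝ³ × ℝ³, F 0 ζ.1 * (F 1 ζ.2.1 * F 2 ζ.2.2)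
      = ∫ ζ : ℝ³ × ℝ³ × ℝ³, F 0 ζ.1 * (F 1 ζ.2.1 * F 2 ζ.2.2) ∂((volume : Measure ℝ³).prod
          (volume : Measure (ℝ³ × ℝ³))) := by rw [← Measure.volume_eq_prod]
    _ = (∫ v, F 0 v) * ∫ w : ℝ³ × ℝ³, F 1 w.1 * F 2 w.2 := integral_prod_mul (F 0) (fun w : ℝ³ × ℝ³ => F 1 w.1 * F 2 w.2)
    _ = (∫ v, F 0 v) * ∫ w : ℝ³ × ℝ³, F 1 w.1 * F 2 w.2 ∂((volume : Measure ℝ³).prod (volume : Measure ℝ³)) := by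
        rw [← Measure.volume_eq_prod]
    _ = (∫ v, F 0 v) * ((∫ v, F 1 v) * ∫ v, F 2 v) := by rw [integral_prod_mul (F 1) (F 2)]

/-- **The main identity for measurable, integrable, divergence-free `Xⱼ`.** [cite: Tao2016AveragedNS, §3.5–3.9 (3.13), (3.15)–(3.16) pp. 17–20] -/
theorem jointWeightAverage_eq (hε : 0 < ε₀) (hε1 : ε₀ ≤ 1 / 100) (hδ : 200 * ε₀ ^ 3 < ndDelta)
    (hψ : NormalisedProfiles ε₀ ψ) (hXm : ∀ j, Measurable (X j)) (hXi : ∀ j, Integrable (X j))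
    (hXd : ∀ j, FreqDivFree (X j)) :
    jointWeightAverage jointMeasure jointE ε₀ (jointF ψ hε) (X 0) (X 1) (X 2) =
      (∫ ξ, cdot (X 0 ξ) (conj3 (𝓕 (⇑(ψ 0)) ξ))) * (∫ ξ, cdot (X 1 ξ) (conj3 (𝓕 (⇑(ψ 1)) ξ))) *
        ∫ ξ, cdot (X 2 ξ) (conj3 (𝓕 (⇑(ψ 2)) ξ)) := by
  have hε1' : ε₀ ≤ 1 / 10 := hε1.trans (by norm_num)
  have hG := integrable_Gfun (ψ := ψ) hε hε1' hδ hXm hXi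
  have hN := integrable_Nfun (ψ := ψ) hε hXm hXi
  -- Step 1: to the quaternion parameter space
  unfold jointWeightAverage
  rw [integral_jointMeasure]
  have e1 : ∀ q : ℍ × ℍ × ℍ, qDensity q • (∫ p : ℝ³ × ℝ³, ((singleScaleWeight ε₀ p : ℝ) : ℂ) *
      jointF ψ hε (quatTripleCLE.symm q, p) *
        Λ p.1 p.2 (rotMat (jointE 0 (quatTripleCLE.symm q)) (X 0 ((jointE 0 (quatTripleCLE.symm q)).symm p.1)))
          (rotMat (jointE 1 (quatTripleCLE.symm q)) (X 1 ((jointE 1 (quatTripleCLE.symm q)).symm p.2)))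
          (rotMat (jointE 2 (quatTripleCLE.symm q)) (X 2 ((jointE 2 (quatTripleCLE.symm q)).symm (-p.1 - p.2))))) =
      ∫ p : ℝ³ × ℝ³, Gfun ψ X hε (q, p) := by
    intro q
    have hqq : quatTripleEquiv (quatTripleCLE.symm q) = q := LinearEquiv.apply_symm_apply _ _
    rw [← MeasureTheory.integral_smul]
    refine integral_congr_ae (ae_of_all _ fun p => ?_)
    dsimp only
    unfold Gfun coreIntegrand Yrot jointF jointE
    rw [hqq, Complex.real_smul]
    simp only [slotQ_zero, slotQ_one, slotQ_two, freq3_zero, freq3_one, freq3_two]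
    ring
  simp_rw [e1]
  -- Step 2: Fubini, fibre step, Fubini back
  have hG' : Integrable (Gfun ψ X hε) ((volume : Measure (ℍ × ℍ × ℍ)).prod (volume : Measure (ℝ³ × ℝ³))) := hG
  have hN' : Integrable (Nfun ψ X hε) ((volume : Measure (ℍ × ℍ × ℍ)).prod (volume : Measure (ℝ³ × ℝ³))) := hN
  have e2 : ∫ q : ℍ × ℍ × ℍ, ∫ p : ℝ³ × ℝ³, Gfun ψ X hε (q, p) = ∫ p : ℝ³ × ℝ³, ∫ q : ℍ × ℍ × ℍ, Gfun ψ X hε (q, p) := by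
    rw [← integral_prod _ hG', integral_prod_symm _ hG']
  rw [e2]
  have e3 : ∫ p : ℝ³ × ℝ³, ∫ q : ℍ × ℍ × ℍ, Gfun ψ X hε (q, p) = ∫ p : ℝ³ × ℝ³, ∫ q : ℍ × ℍ × ℍ, Nfun ψ X hε (q, p) := by
    refine integral_congr_ae ?_
    filter_upwards [hG'.prod_left_ae] with p hp
    exact fibre_step hε hε1 hδ p hp
  rw [e3, ← integral_prod_symm _ hN']
  have e4 : ∫ x, Nfun ψ X hε x ∂((volume : Measure (ℍ × ℍ × ℍ)).prod (volume : Measure (ℝ³ × ℝ³))) =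
      ∫ x, Nfun ψ X hε x := rfl
  rw [e4]
  -- Step 3: disintegration and factorisation
  rw [integral_Nfun hε hε1' hXm, integral_zCut3_hProd hε]
  unfold aVec
  rw [slot_integral_eq hε (hψ 0) (hXd 0), slot_integral_eq hε (hψ 1) (hXd 1), slot_integral_eq hε (hψ 2) (hXd 2),
    mul_assoc]

end Assembly
/-! ### The discharge -/

section Discharge

/-- **Tao 2016, §3.6–3.9: the rotation average with a smooth joint weight reproduces the
product of the profile pairings** — the discharge of the named fact `rotationAverage_jointWeight`.
With `ε₁ = min(1/100, 1, δ/400)` (`δ` the non-degeneracy radius of (3.24)), for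
`0 < ε₀ ≤ ε₁` and normalised profiles `ψⱼ` the data are `d = 4`, the quaternion measure
`jointMeasure`, the rotations `jointE` and the joint weight `jointF ψ` of
`TaoAveragedJointWeightData.lean`; the identity is `jointWeightAverage_eq` after replacing the
`Xⱼ` by strongly measurable representatives. [cite: Tao2016AveragedNS, §3.5–3.9 (3.13), (3.15)–(3.16), (3.20)–(3.24) pp. 17–20] -/
theorem rotationAverage_jointWeight_holds : rotationAverage_jointWeight := by
  have hδ0 := ndDelta_pos
  refine ⟨min (1 / 100) (min 1 (ndDelta / 400)), by positivity, fun ε₀ hε0 hε01 ψ hψ => ?_⟩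
  have hε1 : ε₀ ≤ 1 / 100 := hε01.trans (min_le_left _ _)
  have hε1' : ε₀ ≤ 1 / 10 := hε1.trans (by norm_num)
  have hεone : ε₀ ≤ 1 := hε01.trans ((min_le_right _ _).trans (min_le_left _ _))
  have hεd : ε₀ ≤ ndDelta / 400 := hε01.trans ((min_le_right _ _).trans (min_le_right _ _))
  have hδ : 200 * ε₀ ^ 3 < ndDelta := by
    have h3 : ε₀ ^ 3 ≤ ε₀ := by
      have : ε₀ ^ 2 ≤ 1 := by nlinarith
      nlinarith
    nlinarith
  refine ⟨4, jointMeasure, isFiniteMeasure_jointMeasure, jointE, isRotationFamily_jointE, jointF ψ hε0,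
    contDiff_jointF hε0 hε1' hδ, hasCompactSupport_jointF hε0 hε1', ?_⟩
  intro X₁ X₂ X₃ hi₁ hi₂ hi₃ hd₁ hd₂ hd₃
  -- strongly measurable representatives
  have hY₁ : X₁ =ᵐ[volume] hi₁.1.aestronglyMeasurable.mk X₁ := hi₁.1.aestronglyMeasurable.ae_eq_mk
  have hY₂ : X₂ =ᵐ[volume] hi₂.1.aestronglyMeasurable.mk X₂ := hi₂.1.aestronglyMeasurable.ae_eq_mk
  have hY₃ : X₃ =ᵐ[volume] hi₃.1.aestronglyMeasurable.mk X₃ := hi₃.1.aestronglyMeasurable.ae_eq_mk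
  rw [jointWeightAverage_congr_ae jointMeasure jointE ε₀ (jointF ψ hε0) hY₁ hY₂ hY₃, integral_cdot_congr_ae hY₁,
    integral_cdot_congr_ae hY₂, integral_cdot_congr_ae hY₃]
  set Y : Fin 3 → ℝ³ → ℂ³ := ![hi₁.1.aestronglyMeasurable.mk X₁, hi₂.1.aestronglyMeasurable.mk X₂,
    hi₃.1.aestronglyMeasurable.mk X₃] with hYdef
  have hm : ∀ j, Measurable (Y j) := by
    intro j
    match j with
    | 0 => exact hi₁.1.aestronglyMeasurable.stronglyMeasurable_mk.measurable
    | 1 => exact hi₂.1.aestronglyMeasurable.stronglyMeasurable_mk.measurable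
    | 2 => exact hi₃.1.aestronglyMeasurable.stronglyMeasurable_mk.measurable
  have hi : ∀ j, Integrable (Y j) := by
    intro j
    match j with
    | 0 => exact hi₁.1.congr hY₁
    | 1 => exact hi₂.1.congr hY₂
    | 2 => exact hi₃.1.congr hY₃
  have hd : ∀ j, FreqDivFree (Y j) := by
    intro j
    match j with
    | 0 => exact hd₁.congr_ae hY₁
    | 1 => exact hd₂.congr_ae hY₂
    | 2 => exact hd₃.congr_ae hY₃
  exact jointWeightAverage_eq (ψ := ψ) (X := Y) hε0 hε1 hδ hψ hm hi hd

end Discharge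
end Literature.Analysis.FluidPDE.Tao2016
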